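import Literature.MathematicalPhysics.QuantumFieldTheory.Balaban1983to89.B16Exp198
import Literature.MathematicalPhysics.QuantumFieldTheory.Balaban1983to89.T4NestedLevels
import Literature.Probability.LatticeModels.TruncatedWeightLipschitz

/-!
# `Balaban1983to89.B16Exp198TwoRun` — the TWO-RUN («remnant leaves») half of the (1.98) format: the decay (1.99)/(1.100)
of the pieces 𝐑′^{(k)}(X) SURVIVES the subtraction of two activity families (cell `pub-balaban`, journal row
T4-U5.E-c-REMLEAF*, PAPER SUB-CELL B01 lineage gen 11; record `t4/T4-EST-U5Ec.md` v1.6 §7 (7b); kernel bookkeeping over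
unit b02's `B16Exp198` (the typing of (1.90)/(1.98)) and this lineage's `Literature.Probability.LatticeModels.TruncatedWeightLipschitz`)

HONEST FRAMING (cell `pub-balaban`, T4-DAG PAGE 1).  The cell's T4 target is the existence AND uniqueness of the continuum
limit of Bałaban's unit-scale averaged loop expectations on a finite torus — strictly beyond ultraviolet stability
([Balaban1988Convergent] Cor. 3 p. 264; [Balaban1989LargeFieldII] Thm 1 p. 355), NOT infinite volume, NOT a mass gap, NOT the
Clay problem.  This module is KERNEL
BOOKKEEPING for ONE located species of the two-run («hybrid term-by-term») matching design, the REMNANT LEAVES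
exp 𝐑′^{(k)}(X, U_k) of record `t4/T4-EST-U5Ec.md` §7 (7b): EVERY printed statement below is a ONE-RUN statement at ONE
lattice spacing; the two-run statements proved here are consequences of the FORMAT (1.98) (a Kotecký–Preiss polymer gas) and
of the PROVED two-family Lipschitz bound for the truncated functionals — they hold for ANY two activity families obeying the
Kotecký–Preiss hypothesis (1) on a common geometry.  The activity-level two-run RATE (how small ‖F_A(Z) − F_B(Z)‖ is, in the
age / in the last n₀ steps) is NOT PRINTED anywhere in [Balaban 1983–89]; it stays a BINDER of every theorem of this module
(cell nodes NE-R1 two-run half / NE2⁺-LF / NE7b-rem).  NOTHING of Bałaban's estimates is proved here.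

CITATION HEADER (quotations verified by this seat on the rendered page `b2b-balaban-ref1/pages/1989-cmp122-large-field-II/
1989-cmp122-large-field-II-p036-x2.png` = p. 390, READ AS IMAGE, 2026-08-19).
* [Balaban1989LargeFieldII] T. Bałaban, *Large field renormalization. II. Localization, exponentiation, and bounds for the
  R operation*, Commun. Math. Phys. 122 (1989) 355–392, p. 390: *"The estimate (1.97) is sufficient for convergence of the
  exponentiated cluster expansion, and we have {⋯} = exp 𝐑′^{(k)} = exp Σ 𝐑′^{(k)}(X). (1.98) The summation here is over
  domains X ∈ 𝐃_k, which have nonempty intersections with Z^c_k."*; *"The expression 𝐑′^{(k)}(X) depends on the background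
  field U_k restricted to X, and it can be extended as an analytic function of the variables (𝐔, 𝐉), defined on the space
  Ũ^c_k(X, ã₀, ã₁). It is given by the convergent series (7.13) [I] (with proper notational changes), and it satisfies the
  inequality |𝐑′^{(k)}(X, (𝐔, 𝐉))| ≤ O(1)c₁ exp(−(1 + ½β)κd_{k,∪Y_i}(X)). (1.99)"*; *"hence we have the following more precise
  bound for them: |𝐑′^{(k)}(X, (𝐔, 𝐉))| ≤ exp(−p₀(g_k)) exp(−κd_k(X)). (1.100)"*; (1.101) *"A_k(1/(g_k(·))², U_k) =
  A′_k(1/(g_k(·))², U_k) + Σ_X 𝐑′^{(k)}(X, U_k) + Σ_X 𝐁′^{(k)}(X, U_k)."*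
* [KoteckyPreiss1986] R. Kotecký, D. Preiss, *Cluster expansion for abstract polymer models*, Commun. Math. Phys. 103 (1986)
  491–498: Theorem p. 492 ((1) ⇒ (2)–(5), Φ^T supported on clusters) — in the tree as PROVED theorems
  (`ClusterExpansionKPBound.koteckyPreiss_truncatedWeight_bound_holds`, `ClusterExpansion.truncatedWeight_eq_zero_of_kp`); the
  two-family Lipschitz form along the activity segment is this lineage's `TruncatedWeightLipschitz` ([KP86, §3 (12)–(13)] run on
  w_B + s(w_A − w_B); everything proved).

WHAT IS TYPED, BY NAME.  Unit b02's `B16Exp198.locR ι Λ cubes w X = Σ_{C ∈ coveringFamilies Λ cubes X} Φ^T(C; w)` IS the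
typing of 𝐑′^{(k)}(X) as the X-localized piece of log Ξ of the polymer gas (1.90) (`B16Exp198.logZ_eq_sum_locR` = (1.98),
`B16Exp198.norm_locR_le` = (1.99) with its O(1) exhibited, `B16Exp198.RelSubadd` = the cluster subadditivity leaf giving the
profile d(C) ≥ r₁·d(X) + b); record `t4/T4-EST-U5Ec.md` v1.5 §7 (7b) had left exactly this typing «with the consumers».  This
module does NOT re-type it; it proves, over that typing:
* Part A (abstract, any polymer system; = `TruncatedWeightLipschitz.sum_exp_mul_norm_sum_truncatedWeight_sub_le_of_loc_cluster`
  (v1.3) by name, kept under its v1 name): for a localization map `loc`, pieces R_w(i) = Σ_{C ⊆ L, loc C = i} Φ^T(C; w)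
  and a profile κ with κ(loc C) ≤ d(C) demanded ONLY on the NONEMPTY ι-CLUSTERS C (the families on which a covering-type
  subadditivity can hold — `RelSubadd` is false on non-clusters), Σ_{i ∈ I} e^{κ i}‖R_{wA}(i) − R_{wB}(i)‖ ≤ Σ_{δ ∈ L}‖wA δ −
  wB δ‖e^{a δ + d δ} (`sum_exp_mul_norm_pieces_sub_le`; non-clusters and the empty family contribute Φ^T_A − Φ^T_B = 0 − 0).
* Part B (the polymer gas (1.90), Kotecký–Preiss level): `sum_exp_mul_norm_locR_sub_le` — for two activity families on a COMMON
  geometry (Λ, cubes, ι) obeying hypothesis (1) on Λ with (a, d_K): Σ_{X ∈ 𝒳} e^{κ X}‖locR wA X − locR wB X‖ ≤ Σ_{Z ∈ Λ}‖wA Z − wB Z‖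
  e^{a Z + d_K Z} whenever κ X ≤ d_K(C) on the nonempty clusters covering X; `relSubadd_profile` — `RelSubadd` (junction cost c,
  b ≥ r₁c) gives the (1.99)-profile κ X = r₁·d(X) + b for d_K = (r₁ + s)·d + b, any s ≥ 0; `sum_exp_mul_norm_locR_sub_le_of_relSubadd`.
* Part C (located leaves, the hypotheses of `B16Exp198.kp_condition_rel` for BOTH families: footprint-local incompatibility
  (reach, ν), |F(Z)| ≤ A e^{−R d(Z)} supported in Λ, (1.26)_rel (κ₀, K₀), relative volume bound (c₁), rate κ₀ + r₁ + s + τc₁ ≤ R,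
  smallness A e^{b+τc₁}K₀ν ≤ τ): `kpd_catalogue` (hypothesis (1) on the catalogue), `sum_exp_mul_norm_locR_sub_le_of_leaves`
  (**Σ_X e^{r₁d(X)+b}‖𝐑′_A(X) − 𝐑′_B(X)‖ ≤ Σ_{Z∈Λ}‖F_A(Z) − F_B(Z)‖e^{τ#(Z∖∪Y_i) + (r₁+s)d(Z) + b}**), and the HONEST VOLUME
  FACTOR `sum_exp_mul_norm_locR_sub_le_of_uniform_rate`: a UNIFORM relative rate ‖F_A(Z) − F_B(Z)‖ ≤ ε·A e^{−R d(Z)} only gives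
  ≤ ε·A e^{b+τc₁}·K₀·#Q for any finite set Q of anchoring outside cubes — extensive in the volume; a summable two-run budget for
  the remnant leaves needs the rate ε(Z) to be LOCALIZED / AGE-GRADED at the activity level (cell NE7b-rem, `T4RemnantBooking`;
  NOT PRINTED), which this module leaves as the binder it is.  `discrepancy_budget_le_volume` /
  `sum_exp_mul_norm_locR_sub_le_of_local_rate` give the LOCAL volume factor: families agreeing off a discrepant sub-catalogue
  S ⊆ Λ with the uniform rate on S only ⇒ #Q = the anchoring volume of S (non-extensive when S is window-local).
* Part D (consumer shapes): zero activities (`locR_zero`), the ONE-RUN weighted ℓ¹ bound (`sum_exp_mul_norm_locR_le`, wB = 0 —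
  both runs bounded separately = the SIZE booking of old-born remnants), a LOCAL right-hand side when the two families agree
  off a sub-catalogue D (`sum_exp_mul_norm_locR_sub_le_of_eqOn`), the rate form (`…_of_rate`) and the per-X form
  (`norm_locR_sub_le_of_profile`: ‖Δ𝐑′(X)‖ ≤ e^{−κ X}·budget).
* Part E (hand-off to this lineage's `T4NestedLevels`): a remnant leaf is the positive factor exp Re 𝐑′(X) of the term density
  in each run; ‖𝐑′_A(X) − 𝐑′_B(X)‖ ≤ r_X gives `T4NestedLevels.Sandwiched (−r_X) r_X` for the two runs' leaf values
  (`sandwiched_exp_re_locR`), and the radii of a finite family of remnant leaves sum to at most the activity-discrepancy budget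
  (`sum_norm_locR_sub_le`) — the (l, u) = (−r, r) leaf data of `T4NestedLevels.Ledger.Matched` / `width_le_leafSum`;
  `sandwiched_exp_re_locR_of_profile` = the leaf datum with the (1.99)-profile radius r_X = e^{−κ X}·budget, by name.
  `sandwiched_exp_re_sum_locR` = the whole remnant factor exp Σ_X 𝐑′(X) of one step sandwiched with radius = budget.
* Part F (packaging BY NAME into `T4NestedLevels.Ledger`): for a nested term `t : Ledger ιL O` with distinct leaf labels,
  remnant leaves `rem` with localization domains `dom` (injective on `rem`): `leafSum_remnant_radius_le` (the remnant-leaf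
  radii have `t.leafSum ≤ budget`), `sandwiched_remnant_leaf` (the `Matched` leaf clause with bounds (−r_i, r_i)),
  `leafSum_remnant_width_le` (their share of `t.upper − t.lower` in `Ledger.width_le_leafSum` is ≤ 2·budget).
* Part G (the TWO GROUPS of p. 390 at the two-run level — a CLASS of domains sees only the activities of its own class):
  for a decidable class `P` of polymers and a family `𝒳` of domains all of whose inner polymers lie in the class,
  `locR_eq_locR_filter` (𝐑′(X) over `Λ` = 𝐑′(X) over the sub-catalogue `Λ.filter P` — the two-run form of the mechanism of
  unit b02's `B16Exp198.norm_locR_le`, which demands the activity bound on the inner polymers only), the restrictions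
  `kp1_mono` / `ineq126_mono` / `volBound_mono` / `relSubadd_mono` of hypothesis (1) and of the located leaves to a
  sub-catalogue, the CLASS BUDGET `sum_exp_mul_norm_locR_sub_le_of_class` (**Σ_{X∈𝒳} e^{κ X}‖𝐑′_A(X) − 𝐑′_B(X)‖ ≤
  Σ_{Z∈Λ, P Z}‖wA Z − wB Z‖e^{a Z + d_K Z}**), its one-run form `sum_exp_mul_norm_locR_le_of_class`, its located form
  `sum_exp_mul_norm_locR_sub_le_of_class_rate` (hypothesis (1) from the WEAK uniform constant A of both runs' whole gas, the
  two-run rate on the class with the class's STRONG constant A₀: budget ε·A₀e^{b+τc₁}·K₀·#Q₀), and the one-line sum over a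
  partition `sum_exp_mul_norm_locR_sub_le_two_groups` (ε·e^{b+τc₁}·K₀·(A₀·#Q₀ + A·#Q)).  READING (cell GAPS C-pv14-46 R2):
  P = "misses ⋃_i Y_i", A₀ = e^{−p₀(g_k)}, A = α^{1/3} — the second group's two-run budget inherits the e^{−p₀(g_k)} of (1.100),
  the boundary leaves 𝐁′^{(k)}(X) with X meeting ⋃_i Y_i do not (only Parts B–C with α^{1/3} and the RELATIVE size serve them).

THE TWO GROUPS of p. 390 (*"To the first group we assign all the terms with the localization domains X intersecting the
large field region Z^∼_k ∪ ⋃_i Y^∼_i, to the second group the terms with the domains disjoint with this region. The terms of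
the first group are new boundary terms, and they are denoted by 𝐁′^{(k)}(X)."*) are sub-families `𝒳` of localization
domains of ONE expansion (1.98): every theorem below is stated for an arbitrary finite family `𝒳`, so it serves the remnant
leaves exp 𝐑′^{(k)}(X) and the boundary leaves exp 𝐁′^{(k)}(X) alike (with the profile the consumer can justify on each).

DICTIONARY.  `Dom` = domains of 𝐃_k; `Λ` = the polymers X′ of (1.90); `cubes Z` = the M-cubes of Z (full footprint, for
localization); `out Z` = the cubes of Z∖⋃_i Y_i (incompatibility, KP size a(Z) = τ·#out Z, anchoring); `ι` = incompatibility of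
the gas (1.90); `d` = d_{k,∪Y_i} of (1.67); `wA`, `wB` = the activities F(Z) of (1.90) computed in run A (ε-lattice) and run B
(L⁻¹ε-lattice) at the SAME step on the COMMON background (the synchronisation of the index data is node U5a's, not this
module's); `locR ι Λ cubes w X` = 𝐑′^{(k)}(X).  ABSOLUTE RULE: no display of [Balaban1989LargeFieldII] is asserted; (1.97),
(1.26)_rel, the volume bound, `RelSubadd` and the two-run rate are BINDERS; [KP86] enters only through tree-PROVED theorems.
Everything here is [folklore]-tagged real analysis over those binders.  Value = kernel bookkeeping, NOT summit progress.

VERSIONS.  v1 (p182124, commit a3a2434125a3, 514 l.): Parts A–E with Part A proved in place (the tree then had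
`TruncatedWeightLipschitz` v1.2).  v1.1: Part A = `TruncatedWeightLipschitz` v1.3's `…_of_loc_cluster` BY NAME
(statement unchanged); + `discrepancy_budget_le_volume`, `sum_exp_mul_norm_locR_sub_le_of_local_rate` (the LOCAL volume
factor), `sandwiched_exp_re_sum_locR` (the whole remnant factor of one step); HONEST-FRAMING locator aligned with
`T4NestedLevels` (p182498, commit 595a36bcf2b4, 575 l.).  v1.2: + Part F (`leafSum_remnant_radius_le`, `sandwiched_remnant_leaf`,
`leafSum_remnant_width_le`) (p182531, commit 7ca41afa2b6c, 645 l.).  v1.3 (this file; journal row T4-U5.E-c-BPRIME*, b01 gen 12,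
record `t4/T4-EST-U5Ec.md` v1.8 §8): + Part G (`coveringFamilies_filter_of_class`, `locR_eq_locR_filter`, `kp1_mono`,
`ineq126_mono`, `volBound_mono`, `relSubadd_mono`, `sum_exp_mul_norm_locR_sub_le_of_class`, `sum_exp_mul_norm_locR_le_of_class`,
`sum_exp_mul_norm_locR_sub_le_of_class_rate`, `sum_exp_mul_norm_locR_sub_le_two_groups`).  No earlier statement changed or removed.
-/

open Finset

noncomputable section

namespace Literature.MathematicalPhysics.QuantumFieldTheory.Balaban1983to89.B16Exp198TwoRun

open Literature.Probability.LatticeModels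
open Literature.MathematicalPhysics.QuantumFieldTheory.Balaban1983to89.B13FamilySum
open Literature.MathematicalPhysics.QuantumFieldTheory.Balaban1983to89.B16Exp198
open Literature.MathematicalPhysics.QuantumFieldTheory.Balaban1983to89.T4NestedLevels

/-! ## Part A. Abstract: the decay of localized pieces survives subtraction — profile demanded on nonempty clusters only -/

section Abstract

variable {P : Type*} [DecidableEq P] {inc : P → P → Prop} [DecidableRel inc]

/-- **Decay of localized pieces survives subtraction (cluster-restricted profile).**  Under hypothesis (1) of [KP86] with
(a, d), a, d ≥ 0, for BOTH activity families on the finite volume `L`, a localization map `loc`, a finite set of domains `I`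
and a profile `κ` with `κ (loc C) ≤ Σ_{γ∈C} d γ` for the NONEMPTY ι-CLUSTERS `C ⊆ L` localized in `I`:
`Σ_{i∈I} e^{κ i}‖Σ_{C ⊆ L, loc C = i}(Φ^T(C; wA) − Φ^T(C; wB))‖ ≤ Σ_{δ∈L}‖wA δ − wB δ‖e^{a δ + d δ}`.  The families that are not
clusters carry Φ^T = 0 in both runs ([KP86] Theorem, last assertion; tree `truncatedWeight_eq_zero_of_kp`), the empty family
the same value in both.  = this lineage's `TruncatedWeightLipschitz.sum_exp_mul_norm_sum_truncatedWeight_sub_le_of_loc_cluster`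
(v1.3) BY NAME (v1 of this file carried its own copy of the proof while the tree had TWL v1.2). [folklore] -/
theorem sum_exp_mul_norm_pieces_sub_le [Std.Refl inc] [Std.Symm inc]
    {wA wB : P → ℂ} {a d : P → ℝ} (ha : ∀ γ, 0 ≤ a γ) (hd : ∀ γ, 0 ≤ d γ) {L : Finset P}
    (h1A : ∀ γ ∈ L, ∑ γ' ∈ L with inc γ' γ, ‖wA γ'‖ * Real.exp (a γ' + d γ') ≤ a γ)
    (h1B : ∀ γ ∈ L, ∑ γ' ∈ L with inc γ' γ, ‖wB γ'‖ * Real.exp (a γ' + d γ') ≤ a γ)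
    {κι : Type*} [DecidableEq κι] (loc : Finset P → κι) (I : Finset κι) {κ : κι → ℝ}
    (hκ : ∀ C ⊆ L, C.Nonempty → IsPolymerCluster inc C → loc C ∈ I → κ (loc C) ≤ ∑ γ ∈ C, d γ) :
    ∑ i ∈ I, Real.exp (κ i) *
        ‖∑ C ∈ L.powerset with loc C = i, (truncatedWeight inc wA C - truncatedWeight inc wB C)‖ ≤
      ∑ δ ∈ L, ‖wA δ - wB δ‖ * Real.exp (a δ + d δ) :=
  sum_exp_mul_norm_sum_truncatedWeight_sub_le_of_loc_cluster ha hd h1A h1B loc I hκ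

/-- The ray derivative vanishes at zero activity. [folklore] -/
theorem polymerRayDeriv_zero (Λ : Finset P) (t : ℝ) : polymerRayDeriv inc (0 : P → ℂ) Λ t = 0 := by
  unfold polymerRayDeriv
  refine Finset.sum_eq_zero fun X _ => ?_
  rcases X.eq_empty_or_nonempty with rfl | ⟨γ, hγ⟩
  · simp
  · rw [Finset.prod_eq_zero hγ (Pi.zero_apply γ), mul_zero]

/-- `log Z(Λ; 0) = 0`. [folklore] -/
theorem polymerLogZ_zero (Λ : Finset P) : polymerLogZ inc (0 : P → ℂ) Λ = 0 := by
  unfold polymerLogZ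
  simp [polymerRayDeriv_zero]

/-- `Φ^T(C; 0) = 0`. [folklore] -/
theorem truncatedWeight_zero (C : Finset P) : truncatedWeight inc (0 : P → ℂ) C = 0 := by
  unfold truncatedWeight
  simp [polymerLogZ_zero]

end Abstract

/-! ## Part B. The polymer gas (1.90): the two-run bound for 𝐑′^{(k)}(X) at the Kotecký–Preiss level -/

variable {Dom Cube : Type*} [DecidableEq Dom] [DecidableEq Cube]
variable (ι : Dom → Dom → Prop) [DecidableRel ι]

/-- The two-run difference of 𝐑′^{(k)}(X) is the sum, over the covering families, of the differences of the truncated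
functionals. [folklore] -/
theorem locR_sub_eq_sum (Λ : Finset Dom) (cubes : Dom → Finset Cube) (wA wB : Dom → ℂ) (X : Finset Cube) :
    locR ι Λ cubes wA X - locR ι Λ cubes wB X =
      ∑ C ∈ Λ.powerset with C.biUnion cubes = X, (truncatedWeight ι wA C - truncatedWeight ι wB C) := by
  unfold locR coveringFamilies
  rw [Finset.sum_sub_distrib]

/-- **The two-run bound for the pieces of (1.98), Kotecký–Preiss level.**  Two activity families `wA`, `wB` of the polymer gas
(1.90) on a COMMON geometry (catalogue `Λ`, full footprints `cubes`, incompatibility `ι`) both obeying hypothesis (1) of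
[KP86] on `Λ` with (a, d_K), a, d_K ≥ 0; a finite family `𝒳` of localization domains and a profile `κ` with
`κ X ≤ Σ_{Z∈C} d_K Z` for every NONEMPTY ι-CLUSTER `C ⊆ Λ` whose union of full footprints is `X ∈ 𝒳`.  Then
**Σ_{X∈𝒳} e^{κ X}‖𝐑′_A(X) − 𝐑′_B(X)‖ ≤ Σ_{Z∈Λ}‖wA Z − wB Z‖e^{a Z + d_K Z}** — the decay profile of (1.99)/(1.100) survives the
two-run subtraction piece by piece, at the price of the weighted ℓ¹ activity discrepancy. [folklore] -/
theorem sum_exp_mul_norm_locR_sub_le [Std.Refl ι] [Std.Symm ι] {Λ : Finset Dom} {cubes : Dom → Finset Cube}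
    {a dK : Dom → ℝ} {wA wB : Dom → ℂ} (ha : ∀ Z, 0 ≤ a Z) (hdK : ∀ Z, 0 ≤ dK Z)
    (h1A : ∀ Z ∈ Λ, ∑ Z' ∈ Λ with ι Z' Z, ‖wA Z'‖ * Real.exp (a Z' + dK Z') ≤ a Z)
    (h1B : ∀ Z ∈ Λ, ∑ Z' ∈ Λ with ι Z' Z, ‖wB Z'‖ * Real.exp (a Z' + dK Z') ≤ a Z)
    (𝒳 : Finset (Finset Cube)) {κ : Finset Cube → ℝ}
    (hκ : ∀ X ∈ 𝒳, ∀ C ∈ coveringFamilies Λ cubes X, C.Nonempty → IsPolymerCluster ι C →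
      κ X ≤ ∑ Z ∈ C, dK Z) :
    ∑ X ∈ 𝒳, Real.exp (κ X) * ‖locR ι Λ cubes wA X - locR ι Λ cubes wB X‖ ≤
      ∑ Z ∈ Λ, ‖wA Z - wB Z‖ * Real.exp (a Z + dK Z) := by
  have h := sum_exp_mul_norm_pieces_sub_le (inc := ι) ha hdK h1A h1B (fun C : Finset Dom => C.biUnion cubes) 𝒳
    (κ := κ) fun C hCΛ hne hcl hCX => hκ _ hCX C (mem_coveringFamilies.2 ⟨hCΛ, rfl⟩) hne hcl
  refine le_trans (le_of_eq (Finset.sum_congr rfl fun X _ => ?_)) h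
  rw [locR_sub_eq_sum]

omit [DecidableRel ι] in
/-- **The (1.99)-profile from the relative subadditivity leaf.**  `RelSubadd` (junction cost `c`) on the ι-clusters covering
`X`, `d ≥ 0`, `r₁, s ≥ 0` and a per-member cost `b ≥ r₁c` give, for every NONEMPTY cluster `C` covering `X`,
`r₁·d(X) + b ≤ Σ_{Z∈C}((r₁ + s)·d(Z) + b)` (the algebra of the extraction step of `B16Exp198.norm_locR_le`, without the
anchoring rate). [folklore] -/
theorem relSubadd_profile {Λ : Finset Dom} {cubes : Dom → Finset Cube} {d : Dom → ℝ} {X : Finset Cube}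
    {dX c r₁ s b : ℝ} (hd : ∀ Z, 0 ≤ d Z) (hr₁ : 0 ≤ r₁) (hs : 0 ≤ s) (hb : r₁ * c ≤ b)
    (hsub : RelSubadd ι Λ cubes d X dX c) {C : Finset Dom} (hC : C ∈ coveringFamilies Λ cubes X)
    (hne : C.Nonempty) (hcl : IsPolymerCluster ι C) :
    r₁ * dX + b ≤ ∑ Z ∈ C, ((r₁ + s) * d Z + b) := by
  have hsubC : dX + c ≤ ∑ Z ∈ C, (d Z + c) := hsub C hC hcl
  rw [Finset.sum_add_distrib, Finset.sum_const, nsmul_eq_mul] at hsubC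
  rw [Finset.sum_add_distrib, Finset.sum_const, nsmul_eq_mul, ← Finset.mul_sum]
  have hcard : (1 : ℝ) ≤ (C.card : ℝ) := by exact_mod_cast Finset.card_pos.2 hne
  have hsum : 0 ≤ ∑ Z ∈ C, d Z := Finset.sum_nonneg fun Z _ => hd Z
  have hkey : (r₁ + s) * (∑ Z ∈ C, d Z) + (C.card : ℝ) * b - (r₁ * dX + b) =
      r₁ * ((∑ Z ∈ C, d Z) + (C.card : ℝ) * c - (dX + c)) + s * (∑ Z ∈ C, d Z) +
        ((C.card : ℝ) - 1) * (b - r₁ * c) := by ring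
  have t₁ : 0 ≤ r₁ * ((∑ Z ∈ C, d Z) + (C.card : ℝ) * c - (dX + c)) := mul_nonneg hr₁ (sub_nonneg.2 hsubC)
  have t₂ : 0 ≤ s * (∑ Z ∈ C, d Z) := mul_nonneg hs hsum
  have t₃ : 0 ≤ ((C.card : ℝ) - 1) * (b - r₁ * c) := mul_nonneg (sub_nonneg.2 hcard) (sub_nonneg.2 hb)
  linarith

/-- **The two-run bound with the (1.99)-profile.**  Hypothesis (1) on `Λ` for both families with (a, d_K),
d_K(Z) = (r₁ + s)·d(Z) + b, and `RelSubadd` with cost `c` (b ≥ r₁c) on every `X ∈ 𝒳` give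
**Σ_{X∈𝒳} e^{r₁·d(X) + b}‖𝐑′_A(X) − 𝐑′_B(X)‖ ≤ Σ_{Z∈Λ}‖wA Z − wB Z‖e^{a Z + (r₁+s)d(Z) + b}**. [folklore] -/
theorem sum_exp_mul_norm_locR_sub_le_of_relSubadd [Std.Refl ι] [Std.Symm ι] {Λ : Finset Dom}
    {cubes : Dom → Finset Cube} {d a : Dom → ℝ} {wA wB : Dom → ℂ} {c r₁ s b : ℝ}
    (ha : ∀ Z, 0 ≤ a Z) (hd : ∀ Z, 0 ≤ d Z) (hr₁ : 0 ≤ r₁) (hs : 0 ≤ s) (hc : 0 ≤ c) (hb : r₁ * c ≤ b)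
    (h1A : ∀ Z ∈ Λ, ∑ Z' ∈ Λ with ι Z' Z, ‖wA Z'‖ * Real.exp (a Z' + ((r₁ + s) * d Z' + b)) ≤ a Z)
    (h1B : ∀ Z ∈ Λ, ∑ Z' ∈ Λ with ι Z' Z, ‖wB Z'‖ * Real.exp (a Z' + ((r₁ + s) * d Z' + b)) ≤ a Z)
    (𝒳 : Finset (Finset Cube)) (dX : Finset Cube → ℝ) (hsub : ∀ X ∈ 𝒳, RelSubadd ι Λ cubes d X (dX X) c) :
    ∑ X ∈ 𝒳, Real.exp (r₁ * dX X + b) * ‖locR ι Λ cubes wA X - locR ι Λ cubes wB X‖ ≤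
      ∑ Z ∈ Λ, ‖wA Z - wB Z‖ * Real.exp (a Z + ((r₁ + s) * d Z + b)) := by
  have hb0 : 0 ≤ b := le_trans (mul_nonneg hr₁ hc) hb
  have hdK : ∀ Z, 0 ≤ (r₁ + s) * d Z + b := fun Z => add_nonneg (mul_nonneg (add_nonneg hr₁ hs) (hd Z)) hb0
  exact sum_exp_mul_norm_locR_sub_le ι ha hdK h1A h1B 𝒳 (κ := fun X => r₁ * dX X + b)
    fun X hX C hC hne hcl => relSubadd_profile ι hd hr₁ hs hb (hsub X hX) hC hne hcl

/-! ## Part C. Located leaves: hypothesis (1) from `B16Exp198.kp_condition_rel` for both families -/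

/-- Hypothesis (1) of [KP86] ON THE CATALOGUE `Λ` (the finite-volume shape used by `TruncatedWeightLipschitz`) from the
located leaves of `B16Exp198.kp_condition_rel`: footprint-local incompatibility, activities supported in `Λ` with
|F(Z)| ≤ A e^{−R d(Z)}, (1.26)_rel, the relative volume bound, the rate condition κ₀ + s + τc₁ ≤ R and the smallness
A e^{b+τc₁}K₀ν ≤ τ, with a(Z) = τ·#out Z and d ↦ s·d + b. [folklore] -/
theorem kpd_catalogue [Fintype Dom] {Λ : Finset Dom} {out reach : Dom → Finset Cube} {d : Dom → ℝ}
    {w : Dom → ℂ} {A R κ₀ K₀ c₁ τ s b ν : ℝ}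
    (hloc : ∀ Z, ∀ Z' ∈ Λ, ι Z' Z → ∃ q ∈ reach Z, q ∈ out Z')
    (hreach : ∀ Z, ((reach Z).card : ℝ) ≤ ν * (out Z).card)
    (hd : ∀ Z, 0 ≤ d Z) (hA : 0 ≤ A) (hK₀ : 0 ≤ K₀) (hτ : 0 ≤ τ)
    (hwΛ : ∀ Z, Z ∉ Λ → w Z = 0) (hw : ∀ Z, ‖w Z‖ ≤ A * Real.exp (-(R * d Z)))
    (h126 : Ineq126 Λ out d κ₀ K₀) (hvol : VolBound Λ out d c₁)
    (hrate : κ₀ + s + τ * c₁ ≤ R) (hsmall : A * Real.exp (b + τ * c₁) * K₀ * ν ≤ τ) :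
    ∀ Z ∈ Λ, ∑ Z' ∈ Λ with ι Z' Z,
      ‖w Z'‖ * Real.exp (τ * ((out Z').card : ℝ) + (s * d Z' + b)) ≤ τ * ((out Z).card : ℝ) := by
  intro Z _
  refine le_trans (Finset.sum_le_sum_of_subset_of_nonneg
    (Finset.filter_subset_filter _ (Finset.subset_univ Λ))
    (fun Z' _ _ => mul_nonneg (norm_nonneg _) (Real.exp_nonneg _))) ?_
  exact kp_condition_rel ι hloc hreach hd hA hK₀ hτ hwΛ hw h126 hvol hrate hsmall Z

/-- **The two-run bound for the remnant leaves, located form.**  Two activity families F_A, F_B of the polymer gas (1.90) on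
a COMMON geometry, both supported in `Λ` with |F(Z)| ≤ A e^{−R d(Z)} (the shape of (1.97)), with the common located leaves of
`B16Exp198` ((1.26)_rel, relative volume bound, footprint-local incompatibility), the rate condition κ₀ + r₁ + s + τc₁ ≤ R,
the smallness A e^{b+τc₁}K₀ν ≤ τ, and `RelSubadd` (cost c, b ≥ r₁c) on every X ∈ 𝒳:
**Σ_{X∈𝒳} e^{r₁d(X)+b}‖𝐑′_A(X) − 𝐑′_B(X)‖ ≤ Σ_{Z∈Λ}‖F_A(Z) − F_B(Z)‖·e^{τ#out Z + (r₁+s)d(Z) + b}**.  The right-hand side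
is the weighted ℓ¹ two-run activity discrepancy — a BINDER (NOT PRINTED). [folklore] -/
theorem sum_exp_mul_norm_locR_sub_le_of_leaves [Fintype Dom] [Std.Refl ι] [Std.Symm ι] {Λ : Finset Dom}
    {cubes out reach : Dom → Finset Cube} {d : Dom → ℝ} {wA wB : Dom → ℂ} {A R r₁ s κ₀ K₀ c₁ c b τ ν : ℝ}
    (hloc : ∀ Z, ∀ Z' ∈ Λ, ι Z' Z → ∃ q ∈ reach Z, q ∈ out Z')
    (hreach : ∀ Z, ((reach Z).card : ℝ) ≤ ν * (out Z).card)
    (hd : ∀ Z, 0 ≤ d Z) (hA : 0 ≤ A) (hK₀ : 0 ≤ K₀) (hτ : 0 ≤ τ)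
    (hr₁ : 0 ≤ r₁) (hs : 0 ≤ s) (hc : 0 ≤ c) (hb : r₁ * c ≤ b)
    (hwAΛ : ∀ Z, Z ∉ Λ → wA Z = 0) (hwBΛ : ∀ Z, Z ∉ Λ → wB Z = 0)
    (hwA : ∀ Z, ‖wA Z‖ ≤ A * Real.exp (-(R * d Z))) (hwB : ∀ Z, ‖wB Z‖ ≤ A * Real.exp (-(R * d Z)))
    (h126 : Ineq126 Λ out d κ₀ K₀) (hvol : VolBound Λ out d c₁)
    (hrate : κ₀ + (r₁ + s) + τ * c₁ ≤ R) (hsmall : A * Real.exp (b + τ * c₁) * K₀ * ν ≤ τ)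
    (𝒳 : Finset (Finset Cube)) (dX : Finset Cube → ℝ) (hsub : ∀ X ∈ 𝒳, RelSubadd ι Λ cubes d X (dX X) c) :
    ∑ X ∈ 𝒳, Real.exp (r₁ * dX X + b) * ‖locR ι Λ cubes wA X - locR ι Λ cubes wB X‖ ≤
      ∑ Z ∈ Λ, ‖wA Z - wB Z‖ * Real.exp (τ * ((out Z).card : ℝ) + ((r₁ + s) * d Z + b)) :=
  sum_exp_mul_norm_locR_sub_le_of_relSubadd ι (a := fun Z => τ * ((out Z).card : ℝ))
    (fun _ => mul_nonneg hτ (Nat.cast_nonneg _)) hd hr₁ hs hc hb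
    (kpd_catalogue ι hloc hreach hd hA hK₀ hτ hwAΛ hwA h126 hvol hrate hsmall)
    (kpd_catalogue ι hloc hreach hd hA hK₀ hτ hwBΛ hwB h126 hvol hrate hsmall) 𝒳 dX hsub

/-- **The honest volume factor.**  Under the hypotheses of `sum_exp_mul_norm_locR_sub_le_of_leaves`, a UNIFORM relative
two-run rate on the activities, ‖F_A(Z) − F_B(Z)‖ ≤ ε·A e^{−R d(Z)} on `Λ`, and a finite set `Q` of outside cubes anchoring
every polymer of `Λ` give only **Σ_{X∈𝒳} e^{r₁d(X)+b}‖𝐑′_A(X) − 𝐑′_B(X)‖ ≤ ε · A e^{b+τc₁} · K₀ · #Q** — EXTENSIVE in the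
anchoring volume #Q: a summable two-run budget for the remnant leaves needs a localized / age-graded rate ε(Z) at the activity
level (cell NE7b-rem; NOT PRINTED), not a uniform one. [folklore] -/
theorem sum_exp_mul_norm_locR_sub_le_of_uniform_rate [Fintype Dom] [Std.Refl ι] [Std.Symm ι] {Λ : Finset Dom}
    {cubes out reach : Dom → Finset Cube} {d : Dom → ℝ} {wA wB : Dom → ℂ} {A R r₁ s κ₀ K₀ c₁ c b τ ν ε : ℝ}
    (hloc : ∀ Z, ∀ Z' ∈ Λ, ι Z' Z → ∃ q ∈ reach Z, q ∈ out Z')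
    (hreach : ∀ Z, ((reach Z).card : ℝ) ≤ ν * (out Z).card)
    (hd : ∀ Z, 0 ≤ d Z) (hA : 0 ≤ A) (hK₀ : 0 ≤ K₀) (hτ : 0 ≤ τ) (hε : 0 ≤ ε)
    (hr₁ : 0 ≤ r₁) (hs : 0 ≤ s) (hc : 0 ≤ c) (hb : r₁ * c ≤ b)
    (hwAΛ : ∀ Z, Z ∉ Λ → wA Z = 0) (hwBΛ : ∀ Z, Z ∉ Λ → wB Z = 0)
    (hwA : ∀ Z, ‖wA Z‖ ≤ A * Real.exp (-(R * d Z))) (hwB : ∀ Z, ‖wB Z‖ ≤ A * Real.exp (-(R * d Z)))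
    (hAB : ∀ Z ∈ Λ, ‖wA Z - wB Z‖ ≤ ε * (A * Real.exp (-(R * d Z))))
    (h126 : Ineq126 Λ out d κ₀ K₀) (hvol : VolBound Λ out d c₁)
    (hrate : κ₀ + (r₁ + s) + τ * c₁ ≤ R) (hsmall : A * Real.exp (b + τ * c₁) * K₀ * ν ≤ τ)
    {Q : Finset Cube} (hQ : ∀ Z ∈ Λ, ∃ q ∈ Q, q ∈ out Z)
    (𝒳 : Finset (Finset Cube)) (dX : Finset Cube → ℝ) (hsub : ∀ X ∈ 𝒳, RelSubadd ι Λ cubes d X (dX X) c) :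
    ∑ X ∈ 𝒳, Real.exp (r₁ * dX X + b) * ‖locR ι Λ cubes wA X - locR ι Λ cubes wB X‖ ≤
      ε * (A * Real.exp (b + τ * c₁)) * K₀ * (Q.card : ℝ) := by
  refine (sum_exp_mul_norm_locR_sub_le_of_leaves ι hloc hreach hd hA hK₀ hτ hr₁ hs hc hb hwAΛ hwBΛ hwA hwB
    h126 hvol hrate hsmall 𝒳 dX hsub).trans ?_
  -- pointwise: `‖ΔF(Z)‖ e^{τ #out Z + (r₁+s) d Z + b} ≤ ε A e^{b + τ c₁} e^{-κ₀ d Z}` on `Λ`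
  set g : Dom → ℝ := fun Z => Real.exp (-(κ₀ * d Z)) with hg
  have hg0 : ∀ Z, 0 ≤ g Z := fun Z => Real.exp_nonneg _
  have hpt : ∀ Z ∈ Λ, ‖wA Z - wB Z‖ * Real.exp (τ * ((out Z).card : ℝ) + ((r₁ + s) * d Z + b)) ≤
      ε * (A * Real.exp (b + τ * c₁)) * g Z := by
    intro Z hZΛ
    have hv : τ * ((out Z).card : ℝ) ≤ τ * (c₁ * (1 + d Z)) := mul_le_mul_of_nonneg_left (hvol Z hZΛ) hτ
    have hexp : -(R * d Z) + (τ * (c₁ * (1 + d Z)) + ((r₁ + s) * d Z + b)) =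
        (b + τ * c₁) + -((R - τ * c₁ - (r₁ + s)) * d Z) := by ring
    calc ‖wA Z - wB Z‖ * Real.exp (τ * ((out Z).card : ℝ) + ((r₁ + s) * d Z + b))
        ≤ ε * (A * Real.exp (-(R * d Z))) * Real.exp (τ * (c₁ * (1 + d Z)) + ((r₁ + s) * d Z + b)) :=
          mul_le_mul (hAB Z hZΛ) (Real.exp_le_exp.2 (by linarith)) (Real.exp_nonneg _)
            (mul_nonneg hε (mul_nonneg hA (Real.exp_nonneg _)))
      _ = ε * A * (Real.exp (-(R * d Z)) * Real.exp (τ * (c₁ * (1 + d Z)) + ((r₁ + s) * d Z + b))) := by ring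
      _ = ε * A * (Real.exp (b + τ * c₁) * Real.exp (-((R - τ * c₁ - (r₁ + s)) * d Z))) := by
          rw [← Real.exp_add, hexp, Real.exp_add]
      _ ≤ ε * A * (Real.exp (b + τ * c₁) * g Z) := by
          refine mul_le_mul_of_nonneg_left (mul_le_mul_of_nonneg_left (Real.exp_le_exp.2 (neg_le_neg ?_))
            (Real.exp_nonneg _)) (mul_nonneg hε hA)
          exact mul_le_mul_of_nonneg_right (by linarith) (hd Z)
      _ = ε * (A * Real.exp (b + τ * c₁)) * g Z := by ring
  -- the anchoring cubes cover `Λ`; (1.26)_rel per anchoring cube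
  have hcover : Λ ⊆ Q.biUnion fun q => Λ.filter fun Z => q ∈ out Z := by
    intro Z hZ
    obtain ⟨q, hq, hqZ⟩ := hQ Z hZ
    exact Finset.mem_biUnion.2 ⟨q, hq, Finset.mem_filter.2 ⟨hZ, hqZ⟩⟩
  calc ∑ Z ∈ Λ, ‖wA Z - wB Z‖ * Real.exp (τ * ((out Z).card : ℝ) + ((r₁ + s) * d Z + b))
      ≤ ∑ Z ∈ Λ, ε * (A * Real.exp (b + τ * c₁)) * g Z := Finset.sum_le_sum hpt
    _ = ε * (A * Real.exp (b + τ * c₁)) * ∑ Z ∈ Λ, g Z := by rw [Finset.mul_sum]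
    _ ≤ ε * (A * Real.exp (b + τ * c₁)) * ∑ Z ∈ Q.biUnion (fun q => Λ.filter fun Z => q ∈ out Z), g Z :=
        mul_le_mul_of_nonneg_left (Finset.sum_le_sum_of_subset_of_nonneg hcover fun Z _ _ => hg0 Z)
          (mul_nonneg hε (mul_nonneg hA (Real.exp_nonneg _)))
    _ ≤ ε * (A * Real.exp (b + τ * c₁)) * ∑ q ∈ Q, ∑ Z ∈ Λ.filter (fun Z => q ∈ out Z), g Z :=
        mul_le_mul_of_nonneg_left (sum_biUnion_le_sum_of_nonneg _ _ g hg0)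
          (mul_nonneg hε (mul_nonneg hA (Real.exp_nonneg _)))
    _ ≤ ε * (A * Real.exp (b + τ * c₁)) * ∑ q ∈ Q, K₀ :=
        mul_le_mul_of_nonneg_left (Finset.sum_le_sum fun q _ => h126 q)
          (mul_nonneg hε (mul_nonneg hA (Real.exp_nonneg _)))
    _ = ε * (A * Real.exp (b + τ * c₁)) * K₀ * (Q.card : ℝ) := by
        rw [Finset.sum_const, nsmul_eq_mul]; ring

/-- **The activity-discrepancy budget against the anchoring volume of the DISCREPANT sub-catalogue.**  If the two activity
families agree on `Λ` off a sub-catalogue `S ⊆ Λ` (the polymers built where the two runs' data differ), obey a uniform relative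
rate ‖F_A(Z) − F_B(Z)‖ ≤ ε·A e^{−R d(Z)} on `S`, and a finite set `Q` of outside cubes anchors every polymer of `S`, then — with
(1.26)_rel, the relative volume bound and the rate condition κ₀ + r₁ + s + τc₁ ≤ R on `Λ` — the weighted ℓ¹ discrepancy is
**Σ_{Z∈Λ}‖F_A(Z) − F_B(Z)‖e^{τ#out Z + (r₁+s)d(Z) + b} ≤ ε · A e^{b+τc₁} · K₀ · #Q**: the volume factor is the anchoring volume of
the discrepant sub-catalogue only. [folklore] -/
theorem discrepancy_budget_le_volume {Λ S : Finset Dom} (hS : S ⊆ Λ) {out : Dom → Finset Cube} {d : Dom → ℝ}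
    {wA wB : Dom → ℂ} {A R r₁ s κ₀ K₀ c₁ b τ ε : ℝ}
    (hd : ∀ Z, 0 ≤ d Z) (hA : 0 ≤ A) (hτ : 0 ≤ τ) (hε : 0 ≤ ε)
    (hzero : ∀ Z ∈ Λ, Z ∉ S → wA Z = wB Z)
    (hAB : ∀ Z ∈ S, ‖wA Z - wB Z‖ ≤ ε * (A * Real.exp (-(R * d Z))))
    (h126 : Ineq126 Λ out d κ₀ K₀) (hvol : VolBound Λ out d c₁) (hrate : κ₀ + (r₁ + s) + τ * c₁ ≤ R)
    {Q : Finset Cube} (hQ : ∀ Z ∈ S, ∃ q ∈ Q, q ∈ out Z) :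
    ∑ Z ∈ Λ, ‖wA Z - wB Z‖ * Real.exp (τ * ((out Z).card : ℝ) + ((r₁ + s) * d Z + b)) ≤
      ε * (A * Real.exp (b + τ * c₁)) * K₀ * (Q.card : ℝ) := by
  -- only the discrepant sub-catalogue contributes
  have hΛS : ∑ Z ∈ Λ, ‖wA Z - wB Z‖ * Real.exp (τ * ((out Z).card : ℝ) + ((r₁ + s) * d Z + b)) =
      ∑ Z ∈ S, ‖wA Z - wB Z‖ * Real.exp (τ * ((out Z).card : ℝ) + ((r₁ + s) * d Z + b)) := by
    refine (Finset.sum_subset hS fun Z hZΛ hZS => ?_).symm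
    rw [hzero Z hZΛ hZS, sub_self, norm_zero, zero_mul]
  rw [hΛS]
  -- pointwise: `‖ΔF(Z)‖ e^{τ #out Z + (r₁+s) d Z + b} ≤ ε A e^{b + τ c₁} e^{-κ₀ d Z}` on `S`
  set g : Dom → ℝ := fun Z => Real.exp (-(κ₀ * d Z)) with hg
  have hg0 : ∀ Z, 0 ≤ g Z := fun Z => Real.exp_nonneg _
  have hpt : ∀ Z ∈ S, ‖wA Z - wB Z‖ * Real.exp (τ * ((out Z).card : ℝ) + ((r₁ + s) * d Z + b)) ≤
      ε * (A * Real.exp (b + τ * c₁)) * g Z := by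
    intro Z hZS
    have hv : τ * ((out Z).card : ℝ) ≤ τ * (c₁ * (1 + d Z)) := mul_le_mul_of_nonneg_left (hvol Z (hS hZS)) hτ
    have hexp : -(R * d Z) + (τ * (c₁ * (1 + d Z)) + ((r₁ + s) * d Z + b)) =
        (b + τ * c₁) + -((R - τ * c₁ - (r₁ + s)) * d Z) := by ring
    calc ‖wA Z - wB Z‖ * Real.exp (τ * ((out Z).card : ℝ) + ((r₁ + s) * d Z + b))
        ≤ ε * (A * Real.exp (-(R * d Z))) * Real.exp (τ * (c₁ * (1 + d Z)) + ((r₁ + s) * d Z + b)) :=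
          mul_le_mul (hAB Z hZS) (Real.exp_le_exp.2 (by linarith)) (Real.exp_nonneg _)
            (mul_nonneg hε (mul_nonneg hA (Real.exp_nonneg _)))
      _ = ε * A * (Real.exp (-(R * d Z)) * Real.exp (τ * (c₁ * (1 + d Z)) + ((r₁ + s) * d Z + b))) := by ring
      _ = ε * A * (Real.exp (b + τ * c₁) * Real.exp (-((R - τ * c₁ - (r₁ + s)) * d Z))) := by
          rw [← Real.exp_add, hexp, Real.exp_add]
      _ ≤ ε * A * (Real.exp (b + τ * c₁) * g Z) := by
          refine mul_le_mul_of_nonneg_left (mul_le_mul_of_nonneg_left (Real.exp_le_exp.2 (neg_le_neg ?_))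
            (Real.exp_nonneg _)) (mul_nonneg hε hA)
          exact mul_le_mul_of_nonneg_right (by linarith) (hd Z)
      _ = ε * (A * Real.exp (b + τ * c₁)) * g Z := by ring
  -- the anchoring cubes cover `S`; (1.26)_rel per anchoring cube (over `Λ ⊇ S`)
  have hcover : S ⊆ Q.biUnion fun q => Λ.filter fun Z => q ∈ out Z := by
    intro Z hZ
    obtain ⟨q, hq, hqZ⟩ := hQ Z hZ
    exact Finset.mem_biUnion.2 ⟨q, hq, Finset.mem_filter.2 ⟨hS hZ, hqZ⟩⟩
  calc ∑ Z ∈ S, ‖wA Z - wB Z‖ * Real.exp (τ * ((out Z).card : ℝ) + ((r₁ + s) * d Z + b))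
      ≤ ∑ Z ∈ S, ε * (A * Real.exp (b + τ * c₁)) * g Z := Finset.sum_le_sum hpt
    _ = ε * (A * Real.exp (b + τ * c₁)) * ∑ Z ∈ S, g Z := by rw [Finset.mul_sum]
    _ ≤ ε * (A * Real.exp (b + τ * c₁)) * ∑ Z ∈ Q.biUnion (fun q => Λ.filter fun Z => q ∈ out Z), g Z :=
        mul_le_mul_of_nonneg_left (Finset.sum_le_sum_of_subset_of_nonneg hcover fun Z _ _ => hg0 Z)
          (mul_nonneg hε (mul_nonneg hA (Real.exp_nonneg _)))
    _ ≤ ε * (A * Real.exp (b + τ * c₁)) * ∑ q ∈ Q, ∑ Z ∈ Λ.filter (fun Z => q ∈ out Z), g Z :=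
        mul_le_mul_of_nonneg_left (sum_biUnion_le_sum_of_nonneg _ _ g hg0)
          (mul_nonneg hε (mul_nonneg hA (Real.exp_nonneg _)))
    _ ≤ ε * (A * Real.exp (b + τ * c₁)) * ∑ q ∈ Q, K₀ :=
        mul_le_mul_of_nonneg_left (Finset.sum_le_sum fun q _ => h126 q)
          (mul_nonneg hε (mul_nonneg hA (Real.exp_nonneg _)))
    _ = ε * (A * Real.exp (b + τ * c₁)) * K₀ * (Q.card : ℝ) := by
        rw [Finset.sum_const, nsmul_eq_mul]; ring

/-- **The LOCAL volume factor** (rung +1 of the honest census).  Under the hypotheses of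
`sum_exp_mul_norm_locR_sub_le_of_leaves`, if the two activity families AGREE on `Λ` off a sub-catalogue `S ⊆ Λ` (the polymers
whose data the two runs do not share — e.g. those touching recent large-field structure), obey the uniform relative rate
‖F_A(Z) − F_B(Z)‖ ≤ ε·A e^{−R d(Z)} on `S` only, and `Q` anchors `S`, then
**Σ_{X∈𝒳} e^{r₁d(X)+b}‖𝐑′_A(X) − 𝐑′_B(X)‖ ≤ ε · A e^{b+τc₁} · K₀ · #Q** with #Q the anchoring volume of the DISCREPANT
sub-catalogue — the shape in which a window-local discrepancy gives a NON-extensive two-run budget for ALL remnant leaves at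
once (the localisation of the rate is the consumer's NOT PRINTED input; cell NE7b-rem / NE2⁺-LF). [folklore] -/
theorem sum_exp_mul_norm_locR_sub_le_of_local_rate [Fintype Dom] [Std.Refl ι] [Std.Symm ι] {Λ S : Finset Dom}
    (hS : S ⊆ Λ) {cubes out reach : Dom → Finset Cube} {d : Dom → ℝ} {wA wB : Dom → ℂ}
    {A R r₁ s κ₀ K₀ c₁ c b τ ν ε : ℝ}
    (hloc : ∀ Z, ∀ Z' ∈ Λ, ι Z' Z → ∃ q ∈ reach Z, q ∈ out Z')
    (hreach : ∀ Z, ((reach Z).card : ℝ) ≤ ν * (out Z).card)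
    (hd : ∀ Z, 0 ≤ d Z) (hA : 0 ≤ A) (hK₀ : 0 ≤ K₀) (hτ : 0 ≤ τ) (hε : 0 ≤ ε)
    (hr₁ : 0 ≤ r₁) (hs : 0 ≤ s) (hc : 0 ≤ c) (hb : r₁ * c ≤ b)
    (hwAΛ : ∀ Z, Z ∉ Λ → wA Z = 0) (hwBΛ : ∀ Z, Z ∉ Λ → wB Z = 0)
    (hwA : ∀ Z, ‖wA Z‖ ≤ A * Real.exp (-(R * d Z))) (hwB : ∀ Z, ‖wB Z‖ ≤ A * Real.exp (-(R * d Z)))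
    (hzero : ∀ Z ∈ Λ, Z ∉ S → wA Z = wB Z)
    (hAB : ∀ Z ∈ S, ‖wA Z - wB Z‖ ≤ ε * (A * Real.exp (-(R * d Z))))
    (h126 : Ineq126 Λ out d κ₀ K₀) (hvol : VolBound Λ out d c₁)
    (hrate : κ₀ + (r₁ + s) + τ * c₁ ≤ R) (hsmall : A * Real.exp (b + τ * c₁) * K₀ * ν ≤ τ)
    {Q : Finset Cube} (hQ : ∀ Z ∈ S, ∃ q ∈ Q, q ∈ out Z)
    (𝒳 : Finset (Finset Cube)) (dX : Finset Cube → ℝ) (hsub : ∀ X ∈ 𝒳, RelSubadd ι Λ cubes d X (dX X) c) :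
    ∑ X ∈ 𝒳, Real.exp (r₁ * dX X + b) * ‖locR ι Λ cubes wA X - locR ι Λ cubes wB X‖ ≤
      ε * (A * Real.exp (b + τ * c₁)) * K₀ * (Q.card : ℝ) :=
  (sum_exp_mul_norm_locR_sub_le_of_leaves ι hloc hreach hd hA hK₀ hτ hr₁ hs hc hb hwAΛ hwBΛ hwA hwB
    h126 hvol hrate hsmall 𝒳 dX hsub).trans
    (discrepancy_budget_le_volume hS hd hA hτ hε hzero hAB h126 hvol hrate hQ)

/-! ## Part D. Consumer shapes: one run, a local right-hand side, rates, one piece -/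

/-- 𝐑′^{(k)}(X) of the zero activity family vanishes. [folklore] -/
theorem locR_zero (Λ : Finset Dom) (cubes : Dom → Finset Cube) (X : Finset Cube) :
    locR ι Λ cubes (0 : Dom → ℂ) X = 0 :=
  Finset.sum_eq_zero fun C _ => truncatedWeight_zero C

/-- **ONE RUN, weighted ℓ¹ form** (`wB = 0`): Σ_{X∈𝒳} e^{κ X}‖𝐑′(X)‖ ≤ Σ_{Z∈Λ}‖w Z‖e^{a Z + d_K Z} — both runs' remnant leaves
bounded SEPARATELY (the SIZE booking where no two-run rate is available). [folklore] -/
theorem sum_exp_mul_norm_locR_le [Std.Refl ι] [Std.Symm ι] {Λ : Finset Dom} {cubes : Dom → Finset Cube}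
    {a dK : Dom → ℝ} {w : Dom → ℂ} (ha : ∀ Z, 0 ≤ a Z) (hdK : ∀ Z, 0 ≤ dK Z)
    (h1 : ∀ Z ∈ Λ, ∑ Z' ∈ Λ with ι Z' Z, ‖w Z'‖ * Real.exp (a Z' + dK Z') ≤ a Z)
    (𝒳 : Finset (Finset Cube)) {κ : Finset Cube → ℝ}
    (hκ : ∀ X ∈ 𝒳, ∀ C ∈ coveringFamilies Λ cubes X, C.Nonempty → IsPolymerCluster ι C →
      κ X ≤ ∑ Z ∈ C, dK Z) :
    ∑ X ∈ 𝒳, Real.exp (κ X) * ‖locR ι Λ cubes w X‖ ≤ ∑ Z ∈ Λ, ‖w Z‖ * Real.exp (a Z + dK Z) := by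
  have h0 : ∀ Z ∈ Λ, ∑ Z' ∈ Λ with ι Z' Z, ‖(0 : Dom → ℂ) Z'‖ * Real.exp (a Z' + dK Z') ≤ a Z := by
    intro Z _
    simp only [Pi.zero_apply, norm_zero, zero_mul, Finset.sum_const_zero]
    exact ha Z
  have h := sum_exp_mul_norm_locR_sub_le ι ha hdK h1 h0 𝒳 hκ
  simp only [locR_zero, sub_zero, Pi.zero_apply] at h
  exact h

/-- **A LOCAL right-hand side.**  If the two activity families agree on the polymers of `Λ` outside a sub-catalogue `D` (the
polymers built where the two runs' backgrounds differ), only `Λ ∩ D` contributes to the discrepancy budget. [folklore] -/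
theorem sum_exp_mul_norm_locR_sub_le_of_eqOn [Std.Refl ι] [Std.Symm ι] {Λ : Finset Dom} {cubes : Dom → Finset Cube}
    {a dK : Dom → ℝ} {wA wB : Dom → ℂ} (ha : ∀ Z, 0 ≤ a Z) (hdK : ∀ Z, 0 ≤ dK Z)
    (h1A : ∀ Z ∈ Λ, ∑ Z' ∈ Λ with ι Z' Z, ‖wA Z'‖ * Real.exp (a Z' + dK Z') ≤ a Z)
    (h1B : ∀ Z ∈ Λ, ∑ Z' ∈ Λ with ι Z' Z, ‖wB Z'‖ * Real.exp (a Z' + dK Z') ≤ a Z)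
    (D : Finset Dom) (hD : ∀ Z ∈ Λ, Z ∉ D → wA Z = wB Z)
    (𝒳 : Finset (Finset Cube)) {κ : Finset Cube → ℝ}
    (hκ : ∀ X ∈ 𝒳, ∀ C ∈ coveringFamilies Λ cubes X, C.Nonempty → IsPolymerCluster ι C →
      κ X ≤ ∑ Z ∈ C, dK Z) :
    ∑ X ∈ 𝒳, Real.exp (κ X) * ‖locR ι Λ cubes wA X - locR ι Λ cubes wB X‖ ≤
      ∑ Z ∈ Λ ∩ D, ‖wA Z - wB Z‖ * Real.exp (a Z + dK Z) := by
  refine (sum_exp_mul_norm_locR_sub_le ι ha hdK h1A h1B 𝒳 hκ).trans (le_of_eq ?_)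
  refine (Finset.sum_subset Finset.inter_subset_left fun Z hZΛ hZD => ?_).symm
  have hZ : Z ∉ D := fun h => hZD (Finset.mem_inter.2 ⟨hZΛ, h⟩)
  rw [hD Z hZΛ hZ, sub_self, norm_zero, zero_mul]

/-- **Rate form.**  A two-run rate on the weighted activity discrepancy, ‖wA Z − wB Z‖e^{a Z + d_K Z} ≤ ε·u Z on `Λ`, gives the
budget ε·Σ_{Z∈Λ} u Z. [folklore] -/
theorem sum_exp_mul_norm_locR_sub_le_of_rate [Std.Refl ι] [Std.Symm ι] {Λ : Finset Dom} {cubes : Dom → Finset Cube}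
    {a dK u : Dom → ℝ} {wA wB : Dom → ℂ} {ε : ℝ} (ha : ∀ Z, 0 ≤ a Z) (hdK : ∀ Z, 0 ≤ dK Z)
    (h1A : ∀ Z ∈ Λ, ∑ Z' ∈ Λ with ι Z' Z, ‖wA Z'‖ * Real.exp (a Z' + dK Z') ≤ a Z)
    (h1B : ∀ Z ∈ Λ, ∑ Z' ∈ Λ with ι Z' Z, ‖wB Z'‖ * Real.exp (a Z' + dK Z') ≤ a Z)
    (hε : ∀ Z ∈ Λ, ‖wA Z - wB Z‖ * Real.exp (a Z + dK Z) ≤ ε * u Z)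
    (𝒳 : Finset (Finset Cube)) {κ : Finset Cube → ℝ}
    (hκ : ∀ X ∈ 𝒳, ∀ C ∈ coveringFamilies Λ cubes X, C.Nonempty → IsPolymerCluster ι C →
      κ X ≤ ∑ Z ∈ C, dK Z) :
    ∑ X ∈ 𝒳, Real.exp (κ X) * ‖locR ι Λ cubes wA X - locR ι Λ cubes wB X‖ ≤ ε * ∑ Z ∈ Λ, u Z := by
  refine (sum_exp_mul_norm_locR_sub_le ι ha hdK h1A h1B 𝒳 hκ).trans ?_
  rw [Finset.mul_sum]
  exact Finset.sum_le_sum hε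

/-- **One piece.**  For a single localization domain `X` with profile value `m ≤ Σ_{Z∈C} d_K Z` on the nonempty clusters
covering it: ‖𝐑′_A(X) − 𝐑′_B(X)‖ ≤ e^{−m}·Σ_{Z∈Λ}‖wA Z − wB Z‖e^{a Z + d_K Z} — the per-leaf radius r_X of the remnant leaf
exp 𝐑′(X) (record §7 (7b)). [folklore] -/
theorem norm_locR_sub_le_of_profile [Std.Refl ι] [Std.Symm ι] {Λ : Finset Dom} {cubes : Dom → Finset Cube}
    {a dK : Dom → ℝ} {wA wB : Dom → ℂ} (ha : ∀ Z, 0 ≤ a Z) (hdK : ∀ Z, 0 ≤ dK Z)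
    (h1A : ∀ Z ∈ Λ, ∑ Z' ∈ Λ with ι Z' Z, ‖wA Z'‖ * Real.exp (a Z' + dK Z') ≤ a Z)
    (h1B : ∀ Z ∈ Λ, ∑ Z' ∈ Λ with ι Z' Z, ‖wB Z'‖ * Real.exp (a Z' + dK Z') ≤ a Z)
    (X : Finset Cube) {m : ℝ}
    (hm : ∀ C ∈ coveringFamilies Λ cubes X, C.Nonempty → IsPolymerCluster ι C → m ≤ ∑ Z ∈ C, dK Z) :
    ‖locR ι Λ cubes wA X - locR ι Λ cubes wB X‖ ≤
      Real.exp (-m) * ∑ Z ∈ Λ, ‖wA Z - wB Z‖ * Real.exp (a Z + dK Z) := by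
  have h := sum_exp_mul_norm_locR_sub_le ι ha hdK h1A h1B {X} (κ := fun _ => m)
    fun X' hX' C hC hne hcl => by
      rw [Finset.mem_singleton.1 hX'] at hC
      exact hm C hC hne hcl
  rw [Finset.sum_singleton] at h
  calc ‖locR ι Λ cubes wA X - locR ι Λ cubes wB X‖
      = Real.exp (-m) * (Real.exp m * ‖locR ι Λ cubes wA X - locR ι Λ cubes wB X‖) := by
        rw [← mul_assoc, ← Real.exp_add, neg_add_cancel, Real.exp_zero, one_mul]
    _ ≤ Real.exp (-m) * ∑ Z ∈ Λ, ‖wA Z - wB Z‖ * Real.exp (a Z + dK Z) :=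
        mul_le_mul_of_nonneg_left h (Real.exp_nonneg _)

/-! ## Part E. Hand-off to `T4NestedLevels`: remnant leaves are sandwiched with radius ‖𝐑′_A(X) − 𝐑′_B(X)‖ -/

/-- DICTIONARY (ℂ → ℝ): a norm bound on the difference of two complex numbers sandwiches the exponentials of their real parts:
‖z_A − z_B‖ ≤ r ⇒ e^{−r}e^{Re z_A} ≤ e^{Re z_B} ≤ e^{r}e^{Re z_A}. [folklore] -/
theorem exp_re_sandwich_of_norm_sub_le {zA zB : ℂ} {r : ℝ} (h : ‖zA - zB‖ ≤ r) :
    Real.exp (-r) * Real.exp zA.re ≤ Real.exp zB.re ∧ Real.exp zB.re ≤ Real.exp r * Real.exp zA.re := by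
  have h1 : |zA.re - zB.re| ≤ r := by
    have h2 := Complex.abs_re_le_norm (zA - zB)
    rw [Complex.sub_re] at h2
    exact h2.trans h
  rw [abs_le] at h1
  constructor
  · rw [← Real.exp_add]; exact Real.exp_le_exp.2 (by linarith [h1.2])
  · rw [← Real.exp_add]; exact Real.exp_le_exp.2 (by linarith [h1.1])

/-- **The remnant leaf is sandwiched.**  The positive factors exp Re 𝐑′_A(X) (run A) and exp Re 𝐑′_B(X) (run B) of the term
density, at one common configuration, are `T4NestedLevels.Sandwiched (−r) r` for any `r ≥ ‖𝐑′_A(X) − 𝐑′_B(X)‖` — the leaf data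
(l, u) = (−r_X, r_X) of `T4NestedLevels.Ledger.Matched`. [folklore] -/
theorem sandwiched_exp_re_locR {Λ : Finset Dom} {cubes : Dom → Finset Cube} {wA wB : Dom → ℂ} {X : Finset Cube} {r : ℝ}
    (h : ‖locR ι Λ cubes wA X - locR ι Λ cubes wB X‖ ≤ r) :
    Sandwiched (-r) r (ENNReal.ofReal (Real.exp (locR ι Λ cubes wA X).re))
      (ENNReal.ofReal (Real.exp (locR ι Λ cubes wB X).re)) :=
  Sandwiched.ofReal (exp_re_sandwich_of_norm_sub_le h).1 (exp_re_sandwich_of_norm_sub_le h).2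

/-- **The radii of a finite family of remnant leaves sum to at most the discrepancy budget** (profile κ ≥ 0 on `𝒳`):
Σ_{X∈𝒳}‖𝐑′_A(X) − 𝐑′_B(X)‖ ≤ Σ_{Z∈Λ}‖wA Z − wB Z‖e^{a Z + d_K Z} — the remnant-leaf part of `T4NestedLevels.Ledger.leafSum`
of the half-widths r (the root's width is at most the leaf sum, `T4NestedLevels.Ledger.width_le_leafSum`). [folklore] -/
theorem sum_norm_locR_sub_le [Std.Refl ι] [Std.Symm ι] {Λ : Finset Dom} {cubes : Dom → Finset Cube}
    {a dK : Dom → ℝ} {wA wB : Dom → ℂ} (ha : ∀ Z, 0 ≤ a Z) (hdK : ∀ Z, 0 ≤ dK Z)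
    (h1A : ∀ Z ∈ Λ, ∑ Z' ∈ Λ with ι Z' Z, ‖wA Z'‖ * Real.exp (a Z' + dK Z') ≤ a Z)
    (h1B : ∀ Z ∈ Λ, ∑ Z' ∈ Λ with ι Z' Z, ‖wB Z'‖ * Real.exp (a Z' + dK Z') ≤ a Z)
    (𝒳 : Finset (Finset Cube)) {κ : Finset Cube → ℝ} (hκ0 : ∀ X ∈ 𝒳, 0 ≤ κ X)
    (hκ : ∀ X ∈ 𝒳, ∀ C ∈ coveringFamilies Λ cubes X, C.Nonempty → IsPolymerCluster ι C →
      κ X ≤ ∑ Z ∈ C, dK Z) :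
    ∑ X ∈ 𝒳, ‖locR ι Λ cubes wA X - locR ι Λ cubes wB X‖ ≤
      ∑ Z ∈ Λ, ‖wA Z - wB Z‖ * Real.exp (a Z + dK Z) := by
  refine le_trans (Finset.sum_le_sum fun X hX => ?_) (sum_exp_mul_norm_locR_sub_le ι ha hdK h1A h1B 𝒳 hκ)
  exact le_mul_of_one_le_left (norm_nonneg _) (Real.one_le_exp (hκ0 X hX))

/-- **The remnant leaf exp 𝐑′(X), sandwiched with the (1.99)-profile radius** r_X = e^{−m}·Σ_{Z∈Λ}‖wA Z − wB Z‖e^{a Z + d_K Z}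
(`norm_locR_sub_le_of_profile` ∘ `sandwiched_exp_re_locR`): the by-name leaf datum for `T4NestedLevels.Ledger.Matched`.
[folklore] -/
theorem sandwiched_exp_re_locR_of_profile [Std.Refl ι] [Std.Symm ι] {Λ : Finset Dom} {cubes : Dom → Finset Cube}
    {a dK : Dom → ℝ} {wA wB : Dom → ℂ} (ha : ∀ Z, 0 ≤ a Z) (hdK : ∀ Z, 0 ≤ dK Z)
    (h1A : ∀ Z ∈ Λ, ∑ Z' ∈ Λ with ι Z' Z, ‖wA Z'‖ * Real.exp (a Z' + dK Z') ≤ a Z)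
    (h1B : ∀ Z ∈ Λ, ∑ Z' ∈ Λ with ι Z' Z, ‖wB Z'‖ * Real.exp (a Z' + dK Z') ≤ a Z)
    (X : Finset Cube) {m : ℝ}
    (hm : ∀ C ∈ coveringFamilies Λ cubes X, C.Nonempty → IsPolymerCluster ι C → m ≤ ∑ Z ∈ C, dK Z) :
    Sandwiched (-(Real.exp (-m) * ∑ Z ∈ Λ, ‖wA Z - wB Z‖ * Real.exp (a Z + dK Z)))
      (Real.exp (-m) * ∑ Z ∈ Λ, ‖wA Z - wB Z‖ * Real.exp (a Z + dK Z))
      (ENNReal.ofReal (Real.exp (locR ι Λ cubes wA X).re))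
      (ENNReal.ofReal (Real.exp (locR ι Λ cubes wB X).re)) :=
  sandwiched_exp_re_locR ι (norm_locR_sub_le_of_profile ι ha hdK h1A h1B X hm)

/-- **The whole remnant factor exp Σ_{X∈𝒳} 𝐑′(X) of one step, sandwiched between the two runs** with radius = the
activity-discrepancy budget (profile κ ≥ 0 on `𝒳`): the (1.101)-level statement «A_k^A and A_k^B differ, in their
Σ_X 𝐑′^{(k)}(X) part, by at most Σ_{Z∈Λ}‖F_A Z − F_B Z‖e^{a Z + d_K Z}», as a `T4NestedLevels.Sandwiched` of the
exponentials of the real parts. [folklore] -/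
theorem sandwiched_exp_re_sum_locR [Std.Refl ι] [Std.Symm ι] {Λ : Finset Dom} {cubes : Dom → Finset Cube}
    {a dK : Dom → ℝ} {wA wB : Dom → ℂ} (ha : ∀ Z, 0 ≤ a Z) (hdK : ∀ Z, 0 ≤ dK Z)
    (h1A : ∀ Z ∈ Λ, ∑ Z' ∈ Λ with ι Z' Z, ‖wA Z'‖ * Real.exp (a Z' + dK Z') ≤ a Z)
    (h1B : ∀ Z ∈ Λ, ∑ Z' ∈ Λ with ι Z' Z, ‖wB Z'‖ * Real.exp (a Z' + dK Z') ≤ a Z)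
    (𝒳 : Finset (Finset Cube)) {κ : Finset Cube → ℝ} (hκ0 : ∀ X ∈ 𝒳, 0 ≤ κ X)
    (hκ : ∀ X ∈ 𝒳, ∀ C ∈ coveringFamilies Λ cubes X, C.Nonempty → IsPolymerCluster ι C →
      κ X ≤ ∑ Z ∈ C, dK Z) :
    Sandwiched (-(∑ Z ∈ Λ, ‖wA Z - wB Z‖ * Real.exp (a Z + dK Z)))
      (∑ Z ∈ Λ, ‖wA Z - wB Z‖ * Real.exp (a Z + dK Z))
      (ENNReal.ofReal (Real.exp (∑ X ∈ 𝒳, locR ι Λ cubes wA X).re))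
      (ENNReal.ofReal (Real.exp (∑ X ∈ 𝒳, locR ι Λ cubes wB X).re)) := by
  have h : ‖∑ X ∈ 𝒳, locR ι Λ cubes wA X - ∑ X ∈ 𝒳, locR ι Λ cubes wB X‖ ≤
      ∑ Z ∈ Λ, ‖wA Z - wB Z‖ * Real.exp (a Z + dK Z) := by
    rw [← Finset.sum_sub_distrib]
    exact (norm_sum_le _ _).trans (sum_norm_locR_sub_le ι ha hdK h1A h1B 𝒳 hκ0 hκ)
  exact Sandwiched.ofReal (exp_re_sandwich_of_norm_sub_le h).1 (exp_re_sandwich_of_norm_sub_le h).2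

/-! ## Part F — packaging BY NAME into `T4NestedLevels.Ledger` (the remnant leaves of a nested term)

A nested term of the two-run comparison is a `T4NestedLevels.Ledger ιL O` (leaves of ALL levels, operations `app`).  Its
REMNANT LEAVES are a finite set `rem` of leaf labels with a localization-domain map `dom : ιL → Finset Cube` (leaf `i`
stands for the factor exp 𝐑′(dom i) in each run), injective on `rem` (distinct leaves carry distinct domains of ONE
expansion (1.98)).  The two-run radius of a remnant leaf is `‖locR wA (dom i) − locR wB (dom i)‖`, of any other leaf `0`
here (their data are other seats').  Part F states, by name: the remnant-leaf half-widths have `leafSum ≤ budget`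
(`leafSum_remnant_radius_le`), every remnant leaf is `Matched`-admissible with bounds (−r_i, r_i)
(`sandwiched_remnant_leaf`), and the remnant leaves' contribution to the root width `upper − lower` of
`T4NestedLevels.Ledger.width_le_leafSum` is at most twice the budget (`leafSum_remnant_width_le`). -/

/-- **Remnant-leaf radii of a nested term have leaf sum ≤ the activity-discrepancy budget.**  For a ledger `t` with
distinct leaf labels, remnant leaves `rem` with localization domains `dom` (injective on `rem`):
`t.leafSum (i ↦ if i ∈ rem then ‖locR wA (dom i) − locR wB (dom i)‖ else 0) ≤ Σ_{Z∈Λ}‖wA Z − wB Z‖e^{a Z + d_K Z}`.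
[folklore] -/
theorem leafSum_remnant_radius_le [Std.Refl ι] [Std.Symm ι] {Λ : Finset Dom} {cubes : Dom → Finset Cube}
    {a dK : Dom → ℝ} {wA wB : Dom → ℂ} (ha : ∀ Z, 0 ≤ a Z) (hdK : ∀ Z, 0 ≤ dK Z)
    (h1A : ∀ Z ∈ Λ, ∑ Z' ∈ Λ with ι Z' Z, ‖wA Z'‖ * Real.exp (a Z' + dK Z') ≤ a Z)
    (h1B : ∀ Z ∈ Λ, ∑ Z' ∈ Λ with ι Z' Z, ‖wB Z'‖ * Real.exp (a Z' + dK Z') ≤ a Z)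
    {ιL O : Type*} [DecidableEq ιL] {t : Ledger ιL O} (hnd : t.leaves.Nodup) (rem : Finset ιL)
    {dom : ιL → Finset Cube} (hinj : Set.InjOn dom ↑rem) :
    t.leafSum (fun i => if i ∈ rem then ‖locR ι Λ cubes wA (dom i) - locR ι Λ cubes wB (dom i)‖ else 0) ≤
      ∑ Z ∈ Λ, ‖wA Z - wB Z‖ * Real.exp (a Z + dK Z) := by
  rw [Ledger.leafSum_eq_sum_toFinset _ hnd, ← Finset.sum_filter]
  have hinj' : Set.InjOn dom ↑(t.leaves.toFinset.filter (· ∈ rem)) := fun x hx y hy hxy =>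
    hinj (Finset.mem_filter.1 (Finset.mem_coe.1 hx)).2 (Finset.mem_filter.1 (Finset.mem_coe.1 hy)).2 hxy
  rw [← Finset.sum_image (f := fun X => ‖locR ι Λ cubes wA X - locR ι Λ cubes wB X‖) hinj']
  exact sum_norm_locR_sub_le ι ha hdK h1A h1B _ (κ := fun _ => 0) (fun _ _ => le_rfl)
    (fun X _ C _ _ _ => Finset.sum_nonneg fun Z _ => hdK Z)

/-- **Every remnant leaf is matched with bounds (−r_i, r_i)**, r_i its two-run radius: the leaf clause of
`T4NestedLevels.Ledger.Matched` for leaf values `fA i = exp Re locR wA (dom i)`, `fB i = exp Re locR wB (dom i)`.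
[folklore] -/
theorem sandwiched_remnant_leaf {Λ : Finset Dom} {cubes : Dom → Finset Cube} {wA wB : Dom → ℂ} {ιL : Type*}
    (dom : ιL → Finset Cube) (i : ιL) :
    Sandwiched (-‖locR ι Λ cubes wA (dom i) - locR ι Λ cubes wB (dom i)‖)
      ‖locR ι Λ cubes wA (dom i) - locR ι Λ cubes wB (dom i)‖
      (ENNReal.ofReal (Real.exp (locR ι Λ cubes wA (dom i)).re))
      (ENNReal.ofReal (Real.exp (locR ι Λ cubes wB (dom i)).re)) :=
  sandwiched_exp_re_locR ι le_rfl

/-- **The remnant leaves' share of the root width is at most twice the budget**: with leaf bounds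
`l i = −r_i`, `u i = r_i` on `rem` (and `0` off `rem`), `t.leafSum (u − l) ≤ 2·Σ_{Z∈Λ}‖wA Z − wB Z‖e^{a Z + d_K Z}` — the
quantity bounding `t.upper u − t.lower l` in `T4NestedLevels.Ledger.width_le_leafSum`. [folklore] -/
theorem leafSum_remnant_width_le [Std.Refl ι] [Std.Symm ι] {Λ : Finset Dom} {cubes : Dom → Finset Cube}
    {a dK : Dom → ℝ} {wA wB : Dom → ℂ} (ha : ∀ Z, 0 ≤ a Z) (hdK : ∀ Z, 0 ≤ dK Z)
    (h1A : ∀ Z ∈ Λ, ∑ Z' ∈ Λ with ι Z' Z, ‖wA Z'‖ * Real.exp (a Z' + dK Z') ≤ a Z)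
    (h1B : ∀ Z ∈ Λ, ∑ Z' ∈ Λ with ι Z' Z, ‖wB Z'‖ * Real.exp (a Z' + dK Z') ≤ a Z)
    {ιL O : Type*} [DecidableEq ιL] {t : Ledger ιL O} (hnd : t.leaves.Nodup) (rem : Finset ιL)
    {dom : ιL → Finset Cube} (hinj : Set.InjOn dom ↑rem) :
    let r : ιL → ℝ := fun i => if i ∈ rem then ‖locR ι Λ cubes wA (dom i) - locR ι Λ cubes wB (dom i)‖ else 0
    t.upper r - t.lower (fun i => -r i) ≤ 2 * ∑ Z ∈ Λ, ‖wA Z - wB Z‖ * Real.exp (a Z + dK Z) := by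
  intro r
  have hr0 : ∀ i, 0 ≤ r i := fun i => by
    simp only [r]; split_ifs
    · exact norm_nonneg _
    · exact le_rfl
  have hw := Ledger.width_le_leafSum (l := fun i => -r i) (u := r) (fun i => neg_nonpos.2 (hr0 i)) hr0 t
  have h2 : t.leafSum (fun i => r i - -r i) = 2 * t.leafSum r := by
    rw [show (fun i => r i - -r i) = (fun i => r i + r i) from funext fun i => by ring, Ledger.leafSum_add]; ring
  have hrad : t.leafSum r ≤ ∑ Z ∈ Λ, ‖wA Z - wB Z‖ * Real.exp (a Z + dK Z) :=
    leafSum_remnant_radius_le ι (cubes := cubes) ha hdK h1A h1B hnd rem hinj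
  rw [h2] at hw
  linarith

/-! ## Part G — the two groups of (1.98) (p. 390) at the two-run level: a CLASS of domains sees only its own activities

p. 390 [36] (render `…large-field-II-p036-x2.png`, read as image by the b01 lineage, gen 12): *"Now we divide the terms
𝐑′^{(k)}(X) into two groups. To the first group we assign all the terms with the localization domains X intersecting the
large field region Z^∼_k ∪ ⋃_{i=1}^m Y^∼_i, to the second group the terms with the domains disjoint with this region. The
terms of the first group are new boundary terms, and they are denoted by 𝐁′^{(k)}(X). The terms of the second group give
the basic contribution to the 𝐑-terms in the k-th renormalization step. By their definition the linear size of the domain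
X in (1.99) can be replaced by d_k(X), and c₁ is equal to exp(−p₀(g_k)), hence we have the following more precise bound
for them: |𝐑′^{(k)}(X,(𝐔,𝐉))| ≤ exp(−p₀(g_k)) exp(−κ d_k(X)). (1.100)"*; both groups then enter the new action, (1.101):
*"A_k(1/(g_k(·))², U_k) = A′_k(1/(g_k(·))², U_k) + Σ_X 𝐑′^{(k)}(X, U_k) + Σ_X 𝐁′^{(k)}(X, U_k). (1.101)"*.  The ONE-RUN
mechanism behind *"c₁ is equal to exp(−p₀(g_k))"* is unit b02's `B16Exp198.norm_locR_le` (the activity bound is demanded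
only on the polymers `Z ∈ Λ` with `cubes Z ⊆ X`) and `B16Exp198.ineq199_of_ineq197` (for `X ∩ ⋃_i Y_i = ∅` every polymer
inside `X` misses `⋃_i Y_i`, so the (1.97) constant there is e^{−p₀(g_k)}).  Part G is its TWO-RUN, weighted-ℓ¹ form.  For a
decidable CLASS `P` of polymers and a finite family `𝒳` of domains such that every polymer of `Λ` with footprint inside some
`X ∈ 𝒳` belongs to the class: 𝐑′(X) over `Λ` equals 𝐑′(X) over the sub-catalogue `Λ.filter P` in EACH run
(`locR_eq_locR_filter`); hypothesis (1), (1.26)_rel, the volume bound and `RelSubadd` restrict to any sub-catalogue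
(`kp1_mono`, `ineq126_mono`, `volBound_mono`, `relSubadd_mono`); hence the class's two-run budget is the weighted ℓ¹
activity discrepancy over the CLASS ONLY (`sum_exp_mul_norm_locR_sub_le_of_class`; one run: `sum_exp_mul_norm_locR_le_of_class`)
and, in located form, carries the class's OWN activity constant (`sum_exp_mul_norm_locR_sub_le_of_class_rate`: hypothesis (1)
from the WEAK uniform constant `A` dominating both runs' whole gas — the convergence input —, the two-run rate on the class
with the STRONG constant `A₀`); `sum_exp_mul_norm_locR_sub_le_two_groups` adds the two budgets of a partition 𝒳₀ ∪ 𝒳₁.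
INTENDED READING (cell GAPS C-pv14-46, record R2 — "(1.100) is the bound for the group with c₁ = e^{−p₀(g_k)}; consumers must
not feed it to 𝐁′-leaves" — typed): `P Z` = "Z ∩ ⋃_i Y_i = ∅" (`¬ MeetsLF`), `𝒳₀` = the domains X with X ∩ ⋃_i Y_i = ∅ —
this class CONTAINS the printed second group (X disjoint from Z^∼_k ∪ ⋃_i Y^∼_i) together with the first-group domains
meeting only a collar Y^∼_i∖Y_i or Z^∼_k (= the class of unit b02's `B16.Ineq1100`, cell DIVERGENCE D-b02.11) —, `A₀` =
e^{−p₀(g_k)} (the (1.97) constant on the class), `A` = α^{1/3} ≥ e^{−p₀(g_k)} (g_k small), and on the class d = d_{k,∪Y_i}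
= d_k ((1.67); `B16.RelDomainSys.dRel_eq_of_not_meets`), so the profile e^{r₁d(X)+b} is absolute there.  For the boundary
leaves 𝐁′^{(k)}(X) with X MEETING ⋃_i Y_i the class hypothesis fails (a polymer inside X may meet Y_i: constant α^{1/3},
size RELATIVE to ⋃_i Y_i) and only Parts B–C apply; unit b02's `B16.relDecay_not_fullDecay` is the one-run form of the
same caution.  Nothing printed is asserted: (1.97)'s constants, the located leaves and the two-run rate stay BINDERS. -/

omit [DecidableEq Dom] [DecidableRel ι] in
/-- The covering families of a domain all of whose inner polymers lie in the class `P` are the covering families of the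
sub-catalogue `Λ.filter P`. [folklore] -/
theorem coveringFamilies_filter_of_class {Λ : Finset Dom} {cubes : Dom → Finset Cube} {X : Finset Cube}
    (P : Dom → Prop) [DecidablePred P] (hX : ∀ Z ∈ Λ, cubes Z ⊆ X → P Z) :
    coveringFamilies (Λ.filter P) cubes X = coveringFamilies Λ cubes X := by
  ext C
  simp only [mem_coveringFamilies]
  constructor
  · rintro ⟨hC, hU⟩
    exact ⟨hC.trans (Finset.filter_subset _ _), hU⟩
  · rintro ⟨hC, hU⟩
    refine ⟨fun Z hZ => Finset.mem_filter.2 ⟨hC hZ, hX Z (hC hZ) ?_⟩, hU⟩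
    rw [← hU]
    exact Finset.subset_biUnion_of_mem cubes hZ

/-- **𝐑′(X) of a class domain is 𝐑′(X) of the class sub-catalogue** (each run separately): if every polymer of `Λ` with
footprint inside `X` is in the class `P`, then `locR ι Λ cubes w X = locR ι (Λ.filter P) cubes w X` — the two-run form of
p. 390's *"By their definition … c₁ is equal to exp(−p₀(g_k))"*. [folklore] -/
theorem locR_eq_locR_filter {Λ : Finset Dom} {cubes : Dom → Finset Cube} (w : Dom → ℂ) {X : Finset Cube}
    (P : Dom → Prop) [DecidablePred P] (hX : ∀ Z ∈ Λ, cubes Z ⊆ X → P Z) :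
    locR ι Λ cubes w X = locR ι (Λ.filter P) cubes w X := by
  unfold locR
  rw [coveringFamilies_filter_of_class P hX]

omit [DecidableEq Dom] in
/-- Hypothesis (1) of [KP86] (finite-volume shape, weights (a, d_K)) restricts to a sub-catalogue. [folklore] -/
theorem kp1_mono {Λ Λ' : Finset Dom} (hΛ : Λ' ⊆ Λ) {a dK : Dom → ℝ} {w : Dom → ℂ}
    (h1 : ∀ Z ∈ Λ, ∑ Z' ∈ Λ with ι Z' Z, ‖w Z'‖ * Real.exp (a Z' + dK Z') ≤ a Z) :
    ∀ Z ∈ Λ', ∑ Z' ∈ Λ' with ι Z' Z, ‖w Z'‖ * Real.exp (a Z' + dK Z') ≤ a Z := fun Z hZ =>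
  (Finset.sum_le_sum_of_subset_of_nonneg (Finset.filter_subset_filter _ hΛ)
    fun _ _ _ => mul_nonneg (norm_nonneg _) (Real.exp_nonneg _)).trans (h1 Z (hΛ hZ))

omit [DecidableEq Dom] [DecidableRel ι] in
/-- (1.26)_rel restricts to a sub-catalogue. [folklore] -/
theorem ineq126_mono {Λ Λ' : Finset Dom} (hΛ : Λ' ⊆ Λ) {out : Dom → Finset Cube} {d : Dom → ℝ} {κ₀ K₀ : ℝ}
    (h : Ineq126 Λ out d κ₀ K₀) : Ineq126 Λ' out d κ₀ K₀ := fun q =>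
  (Finset.sum_le_sum_of_subset_of_nonneg (Finset.filter_subset_filter _ hΛ)
    fun _ _ _ => Real.exp_nonneg _).trans (h q)

omit [DecidableEq Dom] [DecidableEq Cube] [DecidableRel ι] in
/-- The relative volume bound restricts to a sub-catalogue. [folklore] -/
theorem volBound_mono {Λ Λ' : Finset Dom} (hΛ : Λ' ⊆ Λ) {out : Dom → Finset Cube} {d : Dom → ℝ} {c₁ : ℝ}
    (h : VolBound Λ out d c₁) : VolBound Λ' out d c₁ := fun Y hY => h Y (hΛ hY)

omit [DecidableRel ι] in
/-- `RelSubadd` restricts to a sub-catalogue (fewer covering families to test). [folklore] -/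
theorem relSubadd_mono {Λ Λ' : Finset Dom} (hΛ : Λ' ⊆ Λ) {cubes : Dom → Finset Cube} {d : Dom → ℝ}
    {X : Finset Cube} {dX c : ℝ} (h : RelSubadd ι Λ cubes d X dX c) : RelSubadd ι Λ' cubes d X dX c :=
  fun C hC hcl =>
    h C (mem_coveringFamilies.2 ⟨(mem_coveringFamilies.1 hC).1.trans hΛ, (mem_coveringFamilies.1 hC).2⟩) hcl

/-- **The class budget (Kotecký–Preiss level).**  Two activity families obeying hypothesis (1) with (a, d_K), a, d_K ≥ 0, on
the class sub-catalogue `Λ.filter P`; a finite family `𝒳` of domains whose inner polymers all lie in the class; a profile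
`κ` with `κ X ≤ Σ_{Z∈C} d_K Z` on the nonempty ι-clusters `C ⊆ Λ` OF CLASS POLYMERS covering `X ∈ 𝒳`.  Then
**Σ_{X∈𝒳} e^{κ X}‖𝐑′_A(X) − 𝐑′_B(X)‖ ≤ Σ_{Z ∈ Λ, P Z}‖wA Z − wB Z‖e^{a Z + d_K Z}** — the pieces of the class see the two-run
activity discrepancy of the CLASS ONLY (𝐑′ computed over the WHOLE catalogue `Λ` on the left). [folklore] -/
theorem sum_exp_mul_norm_locR_sub_le_of_class [Std.Refl ι] [Std.Symm ι] {Λ : Finset Dom} {cubes : Dom → Finset Cube}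
    {a dK : Dom → ℝ} {wA wB : Dom → ℂ} (ha : ∀ Z, 0 ≤ a Z) (hdK : ∀ Z, 0 ≤ dK Z)
    (P : Dom → Prop) [DecidablePred P]
    (h1A : ∀ Z ∈ Λ.filter P, ∑ Z' ∈ Λ.filter P with ι Z' Z, ‖wA Z'‖ * Real.exp (a Z' + dK Z') ≤ a Z)
    (h1B : ∀ Z ∈ Λ.filter P, ∑ Z' ∈ Λ.filter P with ι Z' Z, ‖wB Z'‖ * Real.exp (a Z' + dK Z') ≤ a Z)
    (𝒳 : Finset (Finset Cube)) (h𝒳 : ∀ X ∈ 𝒳, ∀ Z ∈ Λ, cubes Z ⊆ X → P Z) {κ : Finset Cube → ℝ}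
    (hκ : ∀ X ∈ 𝒳, ∀ C ∈ coveringFamilies Λ cubes X, C.Nonempty → IsPolymerCluster ι C → (∀ Z ∈ C, P Z) →
      κ X ≤ ∑ Z ∈ C, dK Z) :
    ∑ X ∈ 𝒳, Real.exp (κ X) * ‖locR ι Λ cubes wA X - locR ι Λ cubes wB X‖ ≤
      ∑ Z ∈ Λ.filter P, ‖wA Z - wB Z‖ * Real.exp (a Z + dK Z) := by
  have hκ' : ∀ X ∈ 𝒳, ∀ C ∈ coveringFamilies (Λ.filter P) cubes X, C.Nonempty → IsPolymerCluster ι C →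
      κ X ≤ ∑ Z ∈ C, dK Z := by
    intro X hX C hC hne hcl
    have hC' := mem_coveringFamilies.1 hC
    exact hκ X hX C (mem_coveringFamilies.2 ⟨hC'.1.trans (Finset.filter_subset _ _), hC'.2⟩) hne hcl
      fun Z hZ => (Finset.mem_filter.1 (hC'.1 hZ)).2
  calc ∑ X ∈ 𝒳, Real.exp (κ X) * ‖locR ι Λ cubes wA X - locR ι Λ cubes wB X‖
      = ∑ X ∈ 𝒳, Real.exp (κ X) * ‖locR ι (Λ.filter P) cubes wA X - locR ι (Λ.filter P) cubes wB X‖ :=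
        Finset.sum_congr rfl fun X hX => by
          rw [locR_eq_locR_filter ι wA P (h𝒳 X hX), locR_eq_locR_filter ι wB P (h𝒳 X hX)]
    _ ≤ ∑ Z ∈ Λ.filter P, ‖wA Z - wB Z‖ * Real.exp (a Z + dK Z) :=
        sum_exp_mul_norm_locR_sub_le ι ha hdK h1A h1B 𝒳 hκ'

/-- **One run, class form** (`wB = 0`): Σ_{X∈𝒳} e^{κ X}‖𝐑′(X)‖ ≤ Σ_{Z ∈ Λ, P Z}‖w Z‖e^{a Z + d_K Z} for a family of class
domains — each run's class leaves SIZE-booked with the class's own activities (hypothesis (1) on the class sub-catalogue).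
[folklore] -/
theorem sum_exp_mul_norm_locR_le_of_class [Std.Refl ι] [Std.Symm ι] {Λ : Finset Dom} {cubes : Dom → Finset Cube}
    {a dK : Dom → ℝ} {w : Dom → ℂ} (ha : ∀ Z, 0 ≤ a Z) (hdK : ∀ Z, 0 ≤ dK Z)
    (P : Dom → Prop) [DecidablePred P]
    (h1 : ∀ Z ∈ Λ.filter P, ∑ Z' ∈ Λ.filter P with ι Z' Z, ‖w Z'‖ * Real.exp (a Z' + dK Z') ≤ a Z)
    (𝒳 : Finset (Finset Cube)) (h𝒳 : ∀ X ∈ 𝒳, ∀ Z ∈ Λ, cubes Z ⊆ X → P Z) {κ : Finset Cube → ℝ}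
    (hκ : ∀ X ∈ 𝒳, ∀ C ∈ coveringFamilies Λ cubes X, C.Nonempty → IsPolymerCluster ι C → (∀ Z ∈ C, P Z) →
      κ X ≤ ∑ Z ∈ C, dK Z) :
    ∑ X ∈ 𝒳, Real.exp (κ X) * ‖locR ι Λ cubes w X‖ ≤ ∑ Z ∈ Λ.filter P, ‖w Z‖ * Real.exp (a Z + dK Z) := by
  have h0 : ∀ Z ∈ Λ.filter P, ∑ Z' ∈ Λ.filter P with ι Z' Z, ‖(0 : Dom → ℂ) Z'‖ * Real.exp (a Z' + dK Z') ≤ a Z := by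
    intro Z _
    simp only [Pi.zero_apply, norm_zero, zero_mul, Finset.sum_const_zero]
    exact ha Z
  have h := sum_exp_mul_norm_locR_sub_le_of_class ι ha hdK P h1 h0 𝒳 h𝒳 hκ
  simp only [locR_zero, sub_zero, Pi.zero_apply] at h
  exact h

/-- **The class budget, located form — the class carries its own activity constant.**  Geometry and located leaves as in
`sum_exp_mul_norm_locR_sub_le_of_local_rate` on the whole catalogue `Λ` (footprint-local incompatibility (reach, ν),
(1.26)_rel (κ₀, K₀), the relative volume bound (c₁), the rate condition κ₀ + r₁ + s + τc₁ ≤ R and the smallness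
A e^{b+τc₁}K₀ν ≤ τ for the WEAK uniform constant `A` with |F(Z)| ≤ A e^{−R d(Z)} for BOTH families — the convergence input
of both runs' gas (1.90)); the two families agree off a discrepant sub-catalogue `S ⊆ Λ`; ON THE CLASS the two-run rate
carries the STRONG constant, ‖F_A(Z) − F_B(Z)‖ ≤ ε·A₀e^{−R d(Z)} for `Z ∈ S` with `P Z`; `Q₀` anchors the discrepant class
polymers at outside cubes; every polymer with footprint inside some `X ∈ 𝒳` lies in the class; `RelSubadd` (cost c,
b ≥ r₁c) on every `X ∈ 𝒳`.  Then **Σ_{X∈𝒳} e^{r₁d(X)+b}‖𝐑′_A(X) − 𝐑′_B(X)‖ ≤ ε · A₀e^{b+τc₁} · K₀ · #Q₀**.  Reading: P =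
"misses ⋃_i Y_i", A = α^{1/3}, A₀ = e^{−p₀(g_k)} — the second group's two-run budget keeps the factor e^{−p₀(g_k)} of (1.100);
no such statement is available for the first-group domains meeting ⋃_i Y_i. [folklore] -/
theorem sum_exp_mul_norm_locR_sub_le_of_class_rate [Fintype Dom] [Std.Refl ι] [Std.Symm ι] {Λ S : Finset Dom}
    (hS : S ⊆ Λ) {cubes out reach : Dom → Finset Cube} {d : Dom → ℝ} {wA wB : Dom → ℂ}
    {A A₀ R r₁ s κ₀ K₀ c₁ c b τ ν ε : ℝ}
    (hloc : ∀ Z, ∀ Z' ∈ Λ, ι Z' Z → ∃ q ∈ reach Z, q ∈ out Z')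
    (hreach : ∀ Z, ((reach Z).card : ℝ) ≤ ν * (out Z).card)
    (hd : ∀ Z, 0 ≤ d Z) (hA : 0 ≤ A) (hA₀ : 0 ≤ A₀) (hK₀ : 0 ≤ K₀) (hτ : 0 ≤ τ) (hε : 0 ≤ ε)
    (hr₁ : 0 ≤ r₁) (hs : 0 ≤ s) (hc : 0 ≤ c) (hb : r₁ * c ≤ b)
    (hwAΛ : ∀ Z, Z ∉ Λ → wA Z = 0) (hwBΛ : ∀ Z, Z ∉ Λ → wB Z = 0)
    (hwA : ∀ Z, ‖wA Z‖ ≤ A * Real.exp (-(R * d Z))) (hwB : ∀ Z, ‖wB Z‖ ≤ A * Real.exp (-(R * d Z)))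
    (hzero : ∀ Z ∈ Λ, Z ∉ S → wA Z = wB Z)
    (P : Dom → Prop) [DecidablePred P]
    (hAB₀ : ∀ Z ∈ S, P Z → ‖wA Z - wB Z‖ ≤ ε * (A₀ * Real.exp (-(R * d Z))))
    (h126 : Ineq126 Λ out d κ₀ K₀) (hvol : VolBound Λ out d c₁)
    (hrate : κ₀ + (r₁ + s) + τ * c₁ ≤ R) (hsmall : A * Real.exp (b + τ * c₁) * K₀ * ν ≤ τ)
    {Q₀ : Finset Cube} (hQ₀ : ∀ Z ∈ S, P Z → ∃ q ∈ Q₀, q ∈ out Z)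
    (𝒳 : Finset (Finset Cube)) (h𝒳 : ∀ X ∈ 𝒳, ∀ Z ∈ Λ, cubes Z ⊆ X → P Z)
    (dX : Finset Cube → ℝ) (hsub : ∀ X ∈ 𝒳, RelSubadd ι Λ cubes d X (dX X) c) :
    ∑ X ∈ 𝒳, Real.exp (r₁ * dX X + b) * ‖locR ι Λ cubes wA X - locR ι Λ cubes wB X‖ ≤
      ε * (A₀ * Real.exp (b + τ * c₁)) * K₀ * (Q₀.card : ℝ) := by
  have hΛ : Λ.filter P ⊆ Λ := Finset.filter_subset _ _
  have hb0 : 0 ≤ b := le_trans (mul_nonneg hr₁ hc) hb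
  have ha : ∀ Z, 0 ≤ τ * ((out Z).card : ℝ) := fun Z => mul_nonneg hτ (Nat.cast_nonneg _)
  have hdK : ∀ Z, 0 ≤ (r₁ + s) * d Z + b := fun Z => add_nonneg (mul_nonneg (add_nonneg hr₁ hs) (hd Z)) hb0
  -- hypothesis (1) on the whole catalogue from the WEAK constant, restricted to the class sub-catalogue
  have h1A : ∀ Z ∈ Λ.filter P, ∑ Z' ∈ Λ.filter P with ι Z' Z,
      ‖wA Z'‖ * Real.exp (τ * ((out Z').card : ℝ) + ((r₁ + s) * d Z' + b)) ≤ τ * ((out Z).card : ℝ) :=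
    kp1_mono ι hΛ (a := fun Z => τ * ((out Z).card : ℝ)) (dK := fun Z => (r₁ + s) * d Z + b)
      (kpd_catalogue ι hloc hreach hd hA hK₀ hτ hwAΛ hwA h126 hvol hrate hsmall)
  have h1B : ∀ Z ∈ Λ.filter P, ∑ Z' ∈ Λ.filter P with ι Z' Z,
      ‖wB Z'‖ * Real.exp (τ * ((out Z').card : ℝ) + ((r₁ + s) * d Z' + b)) ≤ τ * ((out Z).card : ℝ) :=
    kp1_mono ι hΛ (a := fun Z => τ * ((out Z).card : ℝ)) (dK := fun Z => (r₁ + s) * d Z + b)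
      (kpd_catalogue ι hloc hreach hd hA hK₀ hτ hwBΛ hwB h126 hvol hrate hsmall)
  -- the class budget at the Kotecký–Preiss level, with the (1.99)-profile from `RelSubadd`
  have hG := sum_exp_mul_norm_locR_sub_le_of_class ι (a := fun Z => τ * ((out Z).card : ℝ))
    (dK := fun Z => (r₁ + s) * d Z + b) ha hdK P h1A h1B 𝒳 h𝒳 (κ := fun X => r₁ * dX X + b)
    fun X hX C hC hne hcl _ => relSubadd_profile ι hd hr₁ hs hb (hsub X hX) hC hne hcl
  refine hG.trans ?_
  -- the located volume factor on the class sub-catalogue: discrepant class polymers `S.filter P`, strong constant `A₀`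
  have hS' : S.filter P ⊆ Λ.filter P := Finset.filter_subset_filter _ hS
  refine discrepancy_budget_le_volume hS' hd hA₀ hτ hε (fun Z hZ hZS => ?_) (fun Z hZ => ?_)
    (ineq126_mono hΛ h126) (volBound_mono hΛ hvol) hrate (Q := Q₀) fun Z hZ => ?_
  · have hZ' := Finset.mem_filter.1 hZ
    exact hzero Z hZ'.1 fun hZS' => hZS (Finset.mem_filter.2 ⟨hZS', hZ'.2⟩)
  · have hZ' := Finset.mem_filter.1 hZ
    exact hAB₀ Z hZ'.1 hZ'.2
  · have hZ' := Finset.mem_filter.1 hZ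
    exact hQ₀ Z hZ'.1 hZ'.2

/-- **The two groups, one budget line.**  Under the hypotheses of `sum_exp_mul_norm_locR_sub_le_of_class_rate`, plus the WEAK
two-run rate ‖F_A(Z) − F_B(Z)‖ ≤ ε·A e^{−R d(Z)} on all of `S` and an anchoring set `Q` of all discrepant polymers: for a class
family `𝒳₀` (inner polymers in the class) and ANY other finite family `𝒳₁`, **Σ_{X ∈ 𝒳₀ ∪ 𝒳₁} e^{r₁d(X)+b}‖𝐑′_A(X) − 𝐑′_B(X)‖
≤ ε·e^{b+τc₁}·K₀·(A₀·#Q₀ + A·#Q)**.  Reading: 𝒳₀ = the second group (+ collar-only first-group domains) with A₀ = e^{−p₀(g_k)},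
𝒳₁ = the boundary leaves 𝐁′^{(k)}(X) meeting ⋃_i Y_i with A = α^{1/3}. [folklore] -/
theorem sum_exp_mul_norm_locR_sub_le_two_groups [Fintype Dom] [Std.Refl ι] [Std.Symm ι] {Λ S : Finset Dom}
    (hS : S ⊆ Λ) {cubes out reach : Dom → Finset Cube} {d : Dom → ℝ} {wA wB : Dom → ℂ}
    {A A₀ R r₁ s κ₀ K₀ c₁ c b τ ν ε : ℝ}
    (hloc : ∀ Z, ∀ Z' ∈ Λ, ι Z' Z → ∃ q ∈ reach Z, q ∈ out Z')
    (hreach : ∀ Z, ((reach Z).card : ℝ) ≤ ν * (out Z).card)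
    (hd : ∀ Z, 0 ≤ d Z) (hA : 0 ≤ A) (hA₀ : 0 ≤ A₀) (hK₀ : 0 ≤ K₀) (hτ : 0 ≤ τ) (hε : 0 ≤ ε)
    (hr₁ : 0 ≤ r₁) (hs : 0 ≤ s) (hc : 0 ≤ c) (hb : r₁ * c ≤ b)
    (hwAΛ : ∀ Z, Z ∉ Λ → wA Z = 0) (hwBΛ : ∀ Z, Z ∉ Λ → wB Z = 0)
    (hwA : ∀ Z, ‖wA Z‖ ≤ A * Real.exp (-(R * d Z))) (hwB : ∀ Z, ‖wB Z‖ ≤ A * Real.exp (-(R * d Z)))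
    (hzero : ∀ Z ∈ Λ, Z ∉ S → wA Z = wB Z)
    (P : Dom → Prop) [DecidablePred P]
    (hAB₀ : ∀ Z ∈ S, P Z → ‖wA Z - wB Z‖ ≤ ε * (A₀ * Real.exp (-(R * d Z))))
    (hAB : ∀ Z ∈ S, ‖wA Z - wB Z‖ ≤ ε * (A * Real.exp (-(R * d Z))))
    (h126 : Ineq126 Λ out d κ₀ K₀) (hvol : VolBound Λ out d c₁)
    (hrate : κ₀ + (r₁ + s) + τ * c₁ ≤ R) (hsmall : A * Real.exp (b + τ * c₁) * K₀ * ν ≤ τ)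
    {Q₀ Q : Finset Cube} (hQ₀ : ∀ Z ∈ S, P Z → ∃ q ∈ Q₀, q ∈ out Z) (hQ : ∀ Z ∈ S, ∃ q ∈ Q, q ∈ out Z)
    (𝒳₀ 𝒳₁ : Finset (Finset Cube)) (h𝒳₀ : ∀ X ∈ 𝒳₀, ∀ Z ∈ Λ, cubes Z ⊆ X → P Z)
    (dX : Finset Cube → ℝ) (hsub : ∀ X ∈ 𝒳₀ ∪ 𝒳₁, RelSubadd ι Λ cubes d X (dX X) c) :
    ∑ X ∈ 𝒳₀ ∪ 𝒳₁, Real.exp (r₁ * dX X + b) * ‖locR ι Λ cubes wA X - locR ι Λ cubes wB X‖ ≤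
      ε * Real.exp (b + τ * c₁) * K₀ * (A₀ * (Q₀.card : ℝ) + A * (Q.card : ℝ)) := by
  have h0 := sum_exp_mul_norm_locR_sub_le_of_class_rate ι hS hloc hreach hd hA hA₀ hK₀ hτ hε hr₁ hs hc hb hwAΛ hwBΛ
    hwA hwB hzero P hAB₀ h126 hvol hrate hsmall hQ₀ 𝒳₀ h𝒳₀ dX fun X hX => hsub X (Finset.mem_union_left _ hX)
  have h1 := sum_exp_mul_norm_locR_sub_le_of_local_rate ι hS hloc hreach hd hA hK₀ hτ hε hr₁ hs hc hb hwAΛ hwBΛ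
    hwA hwB hzero hAB h126 hvol hrate hsmall hQ 𝒳₁ dX fun X hX => hsub X (Finset.mem_union_right _ hX)
  have hui := Finset.sum_union_inter (s₁ := 𝒳₀) (s₂ := 𝒳₁)
    (f := fun X => Real.exp (r₁ * dX X + b) * ‖locR ι Λ cubes wA X - locR ι Λ cubes wB X‖)
  have hint : 0 ≤ ∑ X ∈ 𝒳₀ ∩ 𝒳₁, Real.exp (r₁ * dX X + b) * ‖locR ι Λ cubes wA X - locR ι Λ cubes wB X‖ :=
    Finset.sum_nonneg fun X _ => mul_nonneg (Real.exp_nonneg _) (norm_nonneg _)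
  have hsplit : ε * Real.exp (b + τ * c₁) * K₀ * (A₀ * (Q₀.card : ℝ) + A * (Q.card : ℝ)) =
      ε * (A₀ * Real.exp (b + τ * c₁)) * K₀ * (Q₀.card : ℝ) + ε * (A * Real.exp (b + τ * c₁)) * K₀ * (Q.card : ℝ) := by
    ring
  rw [hsplit]
  linarith

end Literature.MathematicalPhysics.QuantumFieldTheory.Balaban1983to89.B16Exp198TwoRun
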